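import Literature.Probability.Distributions.GaussianVectorTilt
import Literature.MathematicalPhysics.QuantumFieldTheory.LatticeRPMechanism
import HarnessLib

/-!
# The Gaussian (heat-kernel) double-commutator identity

Topic `Literature/MathematicalPhysics/QuantumFieldTheory`. The operator-free core of the
Fröhlich–Simon–Spencer / Borgs–Seiler "double commutator" estimate for nearest-neighbour
couplings of heat-kernel (Gaussian) type (Borgs–Seiler 1983, §III.2, (III.33)–(III.53); FSS 1976,
Appendix). Let `T(w, w') = exp(−(J/2)‖w − w'‖²)` be the Gaussian kernel on `ℝ^ι` and let
`F : ℝ^ι → ℂ` be a continuous function of polynomial growth with the Gaussian mean-value property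
`∫ F(w + η/J) dγ(η) = F(w)` (`γ = ⨂ N(0, J)`; e.g. any polynomial holomorphic in complex
coordinates, such as a trace of a product of distinct matrix variables — a Polyakov loop). Then
the "double commutator kernel" `|F(w) − F(w')|² T(w, w')` differs from the bounded kernel
`B(w, w') T(w, w')`, `B(w, w') = Cov_γ(F(w + ·/J), F(w' + ·/J))`, by a POSITIVE-DEFINITE kernel
given explicitly in Gram form:

`|F(w) − F(w')|² T(w, w') = B(w, w') T(w, w') − ∫ conj Ψ_η(w) Ψ_η(w') dγ(η)`,
`Ψ_η(v) = (F(v) − F(η/J − v)) · exp(⟨η, v⟩ − J‖v‖²)`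

(`dcKernel_identity`). In the transfer-matrix language this is
`[L̄, [L, T]] = −C* T⁻¹ C + T [L̄, T⁻¹ L T]` with `C = [L, T]`; here it is a finite-dimensional
Gaussian computation (the exponential tilt of `Literature.Probability.Distributions.GaussianPiTilt`
plus algebra), valid pointwise, with no operators, which is what makes it usable inside
reflection-positivity arguments for an arbitrary compact gauge group (the group enters only
through the points `w, w'` at which the kernels are evaluated).

* `gaussianPi ι J = ⨂_{ι} N(0, J)` with its bookkeeping (independent centred Gaussian coordinates
  of variance `J`, `covariance_eval_gaussianPi`; finite moments, `integrable_of_norm_le_pow_gaussianPi`)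
  and the exponential tilt / finite-dimensional Cameron–Martin formula
  `∫ e^{⟨c,x⟩} g(x) dγ = e^{J‖c‖²/2} ∫ g(x + Jc) dγ` (`integral_exp_inner_smul_gaussianPi`, from the
  tree's `Literature.Probability.Distributions.map_add_eq_withDensity_of_hasGaussianLaw`);
* `gaussFeature J η v = exp(⟨η, v⟩ − J‖v‖²)`, `integral_gaussFeature_mul` — the Gram
  representation `∫ φ_η(w) φ_η(w') dγ = T(w, w')` of the heat kernel `heatKernel J`;
* `dcFeature`, `dcKernel` — `Ψ_η` and the Gram kernel `𝒦(w, w') = ∫ conj Ψ_η(w) Ψ_η(w') dγ`;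
* `covKernel` — `B(w, w') = ∫ conj F(w' + η/J) F(w + η/J) dγ − conj F(w') F(w)`;
* `dcKernel_identity` — the identity above.

The second half of the file supplies the function `F` of the lattice application and verifies
the hypotheses and the bound on `B` (Borgs–Seiler's count of "broken Polyakov loops",
(III.49)–(III.58), each broken loop bounded by `χ(1) = N`), again as a finite-dimensional
Gaussian computation:

* `PIdx X L₀ N`, `matOf`, `realify` — real coordinates of `X × L₀` complex `N × N` matrices
  (`X` = transverse sites, `L₀` = time layers); `layerProd v x k = ∏_{m<k} matOf v x m`,
  `polyTrace v x = tr ∏_{m<L₀} matOf v x m` (the Polyakov loop at `x`),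
  `smearedPoly h v = Σ_x h x · polyTrace v x` (the transversally smeared loop);
* `integral_matOf_apply`, `integral_matOf_apply_mul_conj` — under `γ` the layer matrices are
  independent complex Gaussian matrices, `E η_ab = 0`, `E η_ab conj η_cd = 2J δ_ac δ_bd`;
* `integral_polyTrace_shift`, `integral_smearedPoly_shift` — the Gaussian mean-value property
  `∫ F(w + η/J) dγ = F(w)` (each monomial contains each layer at most once);
* `integral_trace_sandwich` — `∫ tr(Q_kᴴ X Q_k) dγ = (1 + 2N/J)^k tr X` for unitary layers;
* `integral_normSq_trace_mul_layerProd`, `integral_normSq_polyTrace_shift` — the variance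
  `∫ |P_x(w + η/J)|² dγ − |P_x(w)|² = (1 + 2N/J)^{L₀} − 1 = Σ_{k≥1} C(L₀,k) (2N/J)^k` EXACTLY
  (Borgs–Seiler's rate `f(J_E)`, `χ(1) = N`);
* `norm_covKernel_smearedPoly_le` — hence `‖B(w, w')‖ ≤ ((1 + 2N/J)^{L₀} − 1) Σ_x ‖h x‖²` on
  unitary inputs (distinct sites are independent; Cauchy–Schwarz in AM–GM form);
* `dcKernel_identity_smearedPoly` — the identity for `F = smearedPoly h`.

Everything here is proved; no named fact. [folklore]

## References

* C. Borgs, E. Seiler, Comm. Math. Phys. 91 (1983) 329–380, §III.2 (III.33)–(III.53)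
  (pp. 349–352). [BorgsSeiler1983]
* J. Fröhlich, B. Simon, T. Spencer, Comm. Math. Phys. 50 (1976) 79–95, Appendix.
-/

noncomputable section

open MeasureTheory ProbabilityTheory Finset
open scoped ENNReal NNReal ComplexConjugate Matrix
open Literature.Probability.Distributions (map_add_eq_withDensity_of_hasGaussianLaw)

namespace Literature.MathematicalPhysics.QuantumFieldTheory

/-! ### The product Gaussian `γ = ⨂ N(0, J)` on `ℝ^ι` and its exponential tilt -/

variable {ι : Type*} [Fintype ι]

/-- The centred product Gaussian `⨂_{i ∈ ι} N(0, J)` on `ι → ℝ`. [folklore] -/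
def gaussianPi (ι : Type*) [Fintype ι] (J : ℝ≥0) : Measure (ι → ℝ) :=
  Measure.pi fun _ : ι => gaussianReal 0 J

variable (J : ℝ≥0)

/-- `gaussianPi` is a probability measure. [folklore] -/
instance isProbabilityMeasure_gaussianPi : IsProbabilityMeasure (gaussianPi ι J) := by
  unfold gaussianPi; infer_instance

/-- Each coordinate of `gaussianPi` is distributed as `N(0, J)`. [folklore] -/
theorem measurePreserving_eval_gaussianPi (i : ι) :
    MeasurePreserving (Function.eval i) (gaussianPi ι J) (gaussianReal 0 J) := by
  unfold gaussianPi
  exact measurePreserving_eval (fun _ : ι => gaussianReal 0 J) i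

/-- The coordinates of `gaussianPi` are independent. [folklore] -/
theorem iIndepFun_eval_gaussianPi :
    iIndepFun (fun (i : ι) (x : ι → ℝ) => x i) (gaussianPi ι J) := by
  unfold gaussianPi
  exact iIndepFun_pi (X := fun _ : ι => @id ℝ) fun _ => aemeasurable_id

/-- Each coordinate of `gaussianPi` is a Gaussian random variable. [folklore] -/
theorem hasGaussianLaw_eval_gaussianPi (i : ι) :
    HasGaussianLaw (fun x : ι → ℝ => x i) (gaussianPi ι J) :=
  ((measurePreserving_eval_gaussianPi J i).hasLaw).hasGaussianLaw

/-- The coordinate vector of `gaussianPi` is a Gaussian vector. [folklore] -/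
theorem hasGaussianLaw_pi_gaussianPi :
    HasGaussianLaw (fun (x : ι → ℝ) (i : ι) => x i) (gaussianPi ι J) :=
  (iIndepFun_eval_gaussianPi J).hasGaussianLaw (hasGaussianLaw_eval_gaussianPi J)

/-- The coordinates are centred. [folklore] -/
theorem integral_eval_gaussianPi (i : ι) : ∫ x, x i ∂gaussianPi ι J = 0 := by
  have h := (measurePreserving_eval_gaussianPi J i).map_eq
  have h2 : ∫ y, y ∂(gaussianPi ι J).map (Function.eval i) = ∫ x, x i ∂gaussianPi ι J :=
    integral_map (μ := gaussianPi ι J) (f := fun y : ℝ => y) (φ := Function.eval (β := fun _ => ℝ) i)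
      (measurable_pi_apply (X := fun _ : ι => ℝ) i).aemeasurable aestronglyMeasurable_id
  rw [← h2, h, integral_id_gaussianReal]

/-- The coordinates have all moments. [folklore] -/
theorem memLp_eval_gaussianPi (i : ι) (p : ℝ≥0) :
    MemLp (fun x : ι → ℝ => x i) p (gaussianPi ι J) :=
  (memLp_id_gaussianReal p).comp_measurePreserving (measurePreserving_eval_gaussianPi J i)

/-- The covariance matrix of the coordinates is `J · 1`. [folklore] -/
theorem covariance_eval_gaussianPi [DecidableEq ι] (i j : ι) :
    cov[fun x : ι → ℝ => x i, fun x : ι → ℝ => x j; gaussianPi ι J] = if i = j then (J : ℝ) else 0 := by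
  split_ifs with hij
  · subst hij
    rw [covariance_self (measurable_pi_apply i).aemeasurable]
    have h := (measurePreserving_eval_gaussianPi J i).variance_fun_comp
      (f := fun y : ℝ => y) aemeasurable_id
    simp only [Function.eval] at h
    rw [h, variance_fun_id_gaussianReal]
  · exact ((iIndepFun_eval_gaussianPi J).indepFun hij).covariance_eq_zero
      (memLp_eval_gaussianPi J i 2) (memLp_eval_gaussianPi J j 2)

/-- **Cameron–Martin / exponential tilt for `gaussianPi` (measure form).** Shifting `γ` by `J c`
tilts it by `exp(⟨c, x⟩ − J‖c‖²/2)`: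
`γ ∘ (· + J c)⁻¹ = exp(Σ cᵢxᵢ − J Σ cᵢ²/2) · γ`. [folklore] -/
theorem gaussianPi_map_add_eq_withDensity (c : ι → ℝ) :
    (gaussianPi ι J).map (fun x => x + (J : ℝ) • c) =
      (gaussianPi ι J).withDensity (fun x => ENNReal.ofReal
        (Real.exp (∑ i, c i * x i - (∑ i, c i * ((J : ℝ) * c i)) / 2))) := by
  classical
  have h := map_add_eq_withDensity_of_hasGaussianLaw (P := gaussianPi ι J)
    (fun (i : ι) (x : ι → ℝ) => x i) (hasGaussianLaw_pi_gaussianPi J)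
    (integral_eval_gaussianPi J) c (fun i => (J : ℝ) * c i) (fun i => by
      simp only [covariance_eval_gaussianPi, ite_mul, zero_mul, Finset.sum_ite_eq, Finset.mem_univ,
        if_true])
  have hid : (fun (x : ι → ℝ) (i : ι) => x i) = id := rfl
  rw [hid, Measure.map_id] at h
  have hfun : (fun x : ι → ℝ => x + (J : ℝ) • c) = fun (ω : ι → ℝ) (i : ι) => ω i + (J : ℝ) * c i := by
    funext ω i; simp [Pi.add_apply, Pi.smul_apply, smul_eq_mul]
  rw [hfun, h]

/-- **Exponential tilt for `gaussianPi` (integral form).** For every `g : (ι → ℝ) → E`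
(`E` a real Banach space) and `c : ι → ℝ`,
`∫ g(x + J c) dγ = ∫ exp(⟨c, x⟩ − J‖c‖²/2) • g(x) dγ`. No integrability hypothesis is needed
(both sides are junk-consistent). [folklore] -/
theorem integral_comp_add_gaussianPi {E : Type*} [NormedAddCommGroup E] [NormedSpace ℝ E]
    [CompleteSpace E] (c : ι → ℝ) (g : (ι → ℝ) → E) (hg : AEStronglyMeasurable g (gaussianPi ι J)) :
    ∫ x, g (x + (J : ℝ) • c) ∂gaussianPi ι J =
      ∫ x, Real.exp (∑ i, c i * x i - (∑ i, c i * ((J : ℝ) * c i)) / 2) • g x ∂gaussianPi ι J := by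
  have hmeas : Measurable fun x : ι → ℝ => x + (J : ℝ) • c := measurable_id.add_const _
  have hg' : AEStronglyMeasurable g ((gaussianPi ι J).map fun x => x + (J : ℝ) • c) := by
    rw [gaussianPi_map_add_eq_withDensity]
    exact hg.mono_ac (withDensity_absolutelyContinuous _ _)
  rw [← integral_map hmeas.aemeasurable hg', gaussianPi_map_add_eq_withDensity]
  have hρ : (fun x : ι → ℝ => ENNReal.ofReal
      (Real.exp (∑ i, c i * x i - (∑ i, c i * ((J : ℝ) * c i)) / 2))) =
      fun x => ((Real.exp (∑ i, c i * x i - (∑ i, c i * ((J : ℝ) * c i)) / 2)).toNNReal : ℝ≥0∞) := rfl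
  rw [hρ, integral_withDensity_eq_integral_smul (by fun_prop)]
  refine integral_congr_ae (Filter.Eventually.of_forall fun x => ?_)
  simp only [NNReal.smul_def, Real.coe_toNNReal _ (Real.exp_nonneg _)]

/-- **Exponential tilt for `gaussianPi` (Gaussian integration by parts, integrated form).**
For every `g : (ι → ℝ) → E` and `c : ι → ℝ`,
`∫ exp(⟨c, x⟩) • g(x) dγ = exp(J Σ cᵢ²/2) • ∫ g(x + J c) dγ`. [folklore] -/
theorem integral_exp_inner_smul_gaussianPi {E : Type*} [NormedAddCommGroup E] [NormedSpace ℝ E]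
    [CompleteSpace E] (c : ι → ℝ) (g : (ι → ℝ) → E) (hg : AEStronglyMeasurable g (gaussianPi ι J)) :
    ∫ x, Real.exp (∑ i, c i * x i) • g x ∂gaussianPi ι J =
      Real.exp ((J : ℝ) * (∑ i, c i ^ 2) / 2) • ∫ x, g (x + (J : ℝ) • c) ∂gaussianPi ι J := by
  rw [integral_comp_add_gaussianPi J c g hg, ← integral_smul]
  refine integral_congr_ae (Filter.Eventually.of_forall fun x => ?_)
  dsimp only
  rw [smul_smul, ← Real.exp_add]
  congr 1
  have : ∑ i, c i * ((J : ℝ) * c i) = (J : ℝ) * ∑ i, c i ^ 2 := by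
    rw [Finset.mul_sum]; exact Finset.sum_congr rfl fun i _ => by ring
  rw [this]; ring

/-! ### Moments and polynomial growth -/

/-- Powers of the sup norm are integrable: `∫ ‖x‖^n dγ < ∞`. [folklore] -/
theorem integrable_pow_norm_gaussianPi (n : ℕ) :
    Integrable (fun x : ι → ℝ => ‖x‖ ^ n) (gaussianPi ι J) := by
  classical
  -- `‖x‖^n ≤ 1 + Σ_i |x_i|^n` for the sup norm
  have hbound : ∀ x : ι → ℝ, ‖x‖ ^ n ≤ 1 + ∑ i, |x i| ^ n := fun x => by
    rcases isEmpty_or_nonempty ι with hι | hι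
    · have hx : x = 0 := funext fun i => (hι.false i).elim
      subst hx
      rw [norm_zero]
      rcases Nat.eq_zero_or_pos n with rfl | hn
      · simp
      · rw [zero_pow hn.ne']; positivity
    · obtain ⟨i, hi⟩ : ∃ i, ‖x‖ = |x i| := by
        obtain ⟨i, -, hi⟩ := Finset.exists_mem_eq_sup (Finset.univ : Finset ι) Finset.univ_nonempty
          (fun j => ‖x j‖₊)
        refine ⟨i, ?_⟩
        rw [Pi.norm_def, hi, coe_nnnorm, Real.norm_eq_abs]
      rw [hi]
      have h1 := Finset.single_le_sum (f := fun j => |x j| ^ n) (fun j _ => by positivity)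
        (Finset.mem_univ i)
      linarith
  have hint : Integrable (fun x : ι → ℝ => 1 + ∑ i, |x i| ^ n) (gaussianPi ι J) := by
    refine (integrable_const _).add (integrable_finsetSum _ fun i _ => ?_)
    have h := (memLp_eval_gaussianPi J i n).integrable_norm_pow'
    simpa [Real.norm_eq_abs] using h
  refine hint.mono' (by fun_prop) (Filter.Eventually.of_forall fun x => ?_)
  rw [Real.norm_eq_abs, abs_of_nonneg (by positivity)]
  exact hbound x

/-- Functions of polynomial growth are integrable: if `‖g x‖ ≤ C (1 + ‖x‖)^n` and `g` is
(ae strongly) measurable then `g` is `γ`-integrable. [folklore] -/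
theorem integrable_of_norm_le_pow_gaussianPi {E : Type*} [NormedAddCommGroup E]
    {g : (ι → ℝ) → E} (hg : AEStronglyMeasurable g (gaussianPi ι J)) {C : ℝ} {n : ℕ}
    (hgb : ∀ x, ‖g x‖ ≤ C * (1 + ‖x‖) ^ n) : Integrable g (gaussianPi ι J) := by
  have h1 : Integrable (fun x : ι → ℝ => C * (1 + ‖x‖) ^ n) (gaussianPi ι J) := by
    refine Integrable.const_mul ?_ C
    -- `(1 + ‖x‖)^n = Σ_k C(n,k) ‖x‖^k`
    have : (fun x : ι → ℝ => (1 + ‖x‖) ^ n) =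
        fun x => ∑ k ∈ Finset.range (n + 1), ‖x‖ ^ k * (n.choose k : ℝ) := by
      funext x
      rw [add_comm, add_pow]
      simp
    rw [this]
    exact integrable_finsetSum _ fun k _ => (integrable_pow_norm_gaussianPi J k).mul_const _
  exact h1.mono' hg (Filter.Eventually.of_forall hgb)


/-! ### The heat kernel and its Gaussian Gram representation -/

/-- The Gaussian (heat) kernel `T_J(w, w') = exp(−(J/2) Σᵢ (wᵢ − w'ᵢ)²)` on `ℝ^ι`. [folklore] -/
def heatKernel (J : ℝ≥0) (w w' : ι → ℝ) : ℝ :=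
  Real.exp (-((J : ℝ) / 2) * ∑ i, (w i - w' i) ^ 2)

/-- The real Gaussian feature `φ_η(v) = exp(Σᵢ ηᵢ vᵢ − J Σᵢ vᵢ²)`. [folklore] -/
def gaussFeature (J : ℝ≥0) (η v : ι → ℝ) : ℝ :=
  Real.exp (∑ i, η i * v i - (J : ℝ) * ∑ i, v i ^ 2)

/-- The heat kernel is positive. [folklore] -/
theorem heatKernel_pos (w w' : ι → ℝ) : 0 < heatKernel J w w' := Real.exp_pos _

/-- The total mass of the tilt: `∫ exp(⟨c, η⟩) dγ(η) = exp(J Σ cᵢ²/2)`. [folklore] -/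
theorem integral_exp_inner_gaussianPi (c : ι → ℝ) :
    ∫ η, Real.exp (∑ i, c i * η i) ∂gaussianPi ι J = Real.exp ((J : ℝ) * (∑ i, c i ^ 2) / 2) := by
  have h := integral_exp_inner_smul_gaussianPi J c (fun _ => (1 : ℝ)) aestronglyMeasurable_const
  simp only [smul_eq_mul, mul_one, integral_const, probReal_univ] at h
  simpa using h

/-- **Gram representation of the heat kernel**: `∫ φ_η(w) φ_η(w') dγ(η) = T_J(w, w')`. [folklore] -/
theorem integral_gaussFeature_mul (w w' : ι → ℝ) :
    ∫ η, gaussFeature J η w * gaussFeature J η w' ∂gaussianPi ι J = heatKernel J w w' := by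
  have hprod : ∀ η : ι → ℝ, gaussFeature J η w * gaussFeature J η w' =
      Real.exp (∑ i, (w i + w' i) * η i) *
        Real.exp (-((J : ℝ) * ∑ i, w i ^ 2) - (J : ℝ) * ∑ i, w' i ^ 2) := fun η => by
    simp only [gaussFeature, ← Real.exp_add]
    congr 1
    have : ∑ i, (w i + w' i) * η i = ∑ i, η i * w i + ∑ i, η i * w' i := by
      rw [← Finset.sum_add_distrib]; exact Finset.sum_congr rfl fun i _ => by ring
    rw [this]; ring
  simp_rw [hprod]
  rw [integral_mul_const, integral_exp_inner_gaussianPi, ← Real.exp_add, heatKernel]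
  congr 1
  have : ∑ i, (w i - w' i) ^ 2 = ∑ i, w i ^ 2 + ∑ i, w' i ^ 2 - 2 * ∑ i, w i * w' i := by
    rw [Finset.mul_sum, ← Finset.sum_add_distrib, ← Finset.sum_sub_distrib]
    exact Finset.sum_congr rfl fun i _ => by ring
  have h2 : ∑ i, (w i + w' i) ^ 2 = ∑ i, w i ^ 2 + ∑ i, w' i ^ 2 + 2 * ∑ i, w i * w' i := by
    rw [Finset.mul_sum, ← Finset.sum_add_distrib, ← Finset.sum_add_distrib]
    exact Finset.sum_congr rfl fun i _ => by ring
  rw [this, h2]; ring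

/-! ### The double-commutator feature and kernels -/

variable (F : (ι → ℝ) → ℂ)

/-- The double-commutator feature `Ψ_η(v) = (F(v) − F(η/J − v)) · φ_η(v)`. [folklore] -/
def dcFeature (η v : ι → ℝ) : ℂ :=
  (F v - F ((J : ℝ)⁻¹ • η - v)) * (gaussFeature J η v : ℂ)

/-- The Gram kernel `𝒦(w, w') = ∫ conj Ψ_η(w) · Ψ_η(w') dγ(η)` (positive definite by
construction). [folklore] -/
def dcKernel (w w' : ι → ℝ) : ℂ :=
  ∫ η, conj (dcFeature J F η w) * dcFeature J F η w' ∂gaussianPi ι J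

/-- The covariance kernel `B(w, w') = ∫ conj F(w' + η/J) · F(w + η/J) dγ(η) − conj F(w') F(w)`
(`= Cov_γ(F(w + ·/J), F(w' + ·/J))` when `F` has the Gaussian mean-value property).
[folklore] -/
def covKernel (w w' : ι → ℝ) : ℂ :=
  (∫ η, conj (F (w' + (J : ℝ)⁻¹ • η)) * F (w + (J : ℝ)⁻¹ • η) ∂gaussianPi ι J) - conj (F w') * F w

/-! ### Growth and integrability bookkeeping -/

variable {F J}

/-- Polynomial growth is stable under the substitution `η ↦ a + η/J`:
`‖F(a + η/J)‖ ≤ C (1 + ‖a‖ + J⁻¹)ⁿ (1 + ‖η‖)ⁿ`. [folklore] -/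
theorem norm_apply_affine_le {C : ℝ} {n : ℕ} (hFb : ∀ v, ‖F v‖ ≤ C * (1 + ‖v‖) ^ n)
    (hC : 0 ≤ C) (a η : ι → ℝ) :
    ‖F (a + (J : ℝ)⁻¹ • η)‖ ≤ C * (1 + ‖a‖ + (J : ℝ)⁻¹) ^ n * (1 + ‖η‖) ^ n := by
  have hJ0 : 0 ≤ (J : ℝ)⁻¹ := inv_nonneg.2 J.coe_nonneg
  have hnorm : ‖a + (J : ℝ)⁻¹ • η‖ ≤ ‖a‖ + (J : ℝ)⁻¹ * ‖η‖ := by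
    calc ‖a + (J : ℝ)⁻¹ • η‖ ≤ ‖a‖ + ‖(J : ℝ)⁻¹ • η‖ := norm_add_le _ _
      _ = ‖a‖ + (J : ℝ)⁻¹ * ‖η‖ := by rw [norm_smul, Real.norm_eq_abs, abs_of_nonneg hJ0]
  have hkey : 1 + ‖a + (J : ℝ)⁻¹ • η‖ ≤ (1 + ‖a‖ + (J : ℝ)⁻¹) * (1 + ‖η‖) := by
    have ha := norm_nonneg a
    have hη := norm_nonneg η
    nlinarith [mul_nonneg ha hη, mul_nonneg hJ0 hη]
  calc ‖F (a + (J : ℝ)⁻¹ • η)‖ ≤ C * (1 + ‖a + (J : ℝ)⁻¹ • η‖) ^ n := hFb _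
    _ ≤ C * ((1 + ‖a‖ + (J : ℝ)⁻¹) * (1 + ‖η‖)) ^ n := by gcongr
    _ = C * (1 + ‖a‖ + (J : ℝ)⁻¹) ^ n * (1 + ‖η‖) ^ n := by rw [mul_pow]; ring

/-- `η ↦ F(a + η/J)` is integrable for continuous `F` of polynomial growth. [folklore] -/
theorem integrable_apply_add (hF : Continuous F) {C : ℝ} {n : ℕ} (hC : 0 ≤ C)
    (hFb : ∀ v, ‖F v‖ ≤ C * (1 + ‖v‖) ^ n) (a : ι → ℝ) :
    Integrable (fun η => F (a + (J : ℝ)⁻¹ • η)) (gaussianPi ι J) :=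
  integrable_of_norm_le_pow_gaussianPi J ((hF.comp (by fun_prop)).aestronglyMeasurable)
    (C := C * (1 + ‖a‖ + (J : ℝ)⁻¹) ^ n) (n := n) fun η => norm_apply_affine_le hFb hC a η

/-- `η ↦ F(η/J − a)` is integrable for continuous `F` of polynomial growth. [folklore] -/
theorem integrable_apply_sub (hF : Continuous F) {C : ℝ} {n : ℕ} (hC : 0 ≤ C)
    (hFb : ∀ v, ‖F v‖ ≤ C * (1 + ‖v‖) ^ n) (a : ι → ℝ) :
    Integrable (fun η => F ((J : ℝ)⁻¹ • η - a)) (gaussianPi ι J) := by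
  have h := integrable_apply_add (J := J) hF hC hFb (-a)
  refine h.congr (Filter.Eventually.of_forall fun η => ?_)
  simp only [neg_add_eq_sub]

/-- Products `conj F(a + η/J) · F(b + η/J)` are integrable. [folklore] -/
theorem integrable_conj_mul (hF : Continuous F) {C : ℝ} {n : ℕ} (hC : 0 ≤ C)
    (hFb : ∀ v, ‖F v‖ ≤ C * (1 + ‖v‖) ^ n) (a b : ι → ℝ) :
    Integrable (fun η => conj (F (a + (J : ℝ)⁻¹ • η)) * F (b + (J : ℝ)⁻¹ • η))
      (gaussianPi ι J) := by
  have hm : AEStronglyMeasurable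
      (fun η => conj (F (a + (J : ℝ)⁻¹ • η)) * F (b + (J : ℝ)⁻¹ • η)) (gaussianPi ι J) :=
    ((Complex.continuous_conj.comp (hF.comp (by fun_prop))).mul
      (hF.comp (by fun_prop))).aestronglyMeasurable
  refine integrable_of_norm_le_pow_gaussianPi J hm
    (C := C * (1 + ‖a‖ + (J : ℝ)⁻¹) ^ n * (C * (1 + ‖b‖ + (J : ℝ)⁻¹) ^ n)) (n := n + n)
    fun η => ?_
  have h1 := norm_apply_affine_le (J := J) hFb hC a η
  have h2 := norm_apply_affine_le (J := J) hFb hC b η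
  rw [norm_mul, Complex.norm_conj, pow_add]
  have hA : 0 ≤ C * (1 + ‖a‖ + (J : ℝ)⁻¹) ^ n := by
    have : 0 ≤ (J : ℝ)⁻¹ := inv_nonneg.2 J.coe_nonneg; positivity
  calc ‖F (a + (J : ℝ)⁻¹ • η)‖ * ‖F (b + (J : ℝ)⁻¹ • η)‖
      ≤ (C * (1 + ‖a‖ + (J : ℝ)⁻¹) ^ n * (1 + ‖η‖) ^ n) *
          (C * (1 + ‖b‖ + (J : ℝ)⁻¹) ^ n * (1 + ‖η‖) ^ n) :=
        mul_le_mul h1 h2 (norm_nonneg _) (by positivity)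
    _ = C * (1 + ‖a‖ + (J : ℝ)⁻¹) ^ n * (C * (1 + ‖b‖ + (J : ℝ)⁻¹) ^ n) *
          ((1 + ‖η‖) ^ n * (1 + ‖η‖) ^ n) := by ring

/-! ### The identity -/

omit [Fintype ι] in
/-- The tilt direction `w + w'` turns the features at `w` and `w'` into shifted evaluations of
`F`: for `J ≠ 0`, `(η + J(w + w'))/J − w = w' + η/J`. [folklore] -/
theorem inv_smul_add_smul_sub (hJ : (J : ℝ) ≠ 0) (w w' η : ι → ℝ) :
    (J : ℝ)⁻¹ • (η + (J : ℝ) • (w + w')) - w = w' + (J : ℝ)⁻¹ • η := by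
  rw [smul_add, smul_smul, inv_mul_cancel₀ hJ, one_smul]; abel

/-- **The Gaussian double-commutator identity.** Let `F : ℝ^ι → ℂ` be continuous, of polynomial
growth, with the Gaussian mean-value property `∫ F(w + η/J) dγ(η) = F(w)` for all `w`
(`γ = ⨂_{ι} N(0, J)`, `J > 0`). Then for all `w, w'`,
`|F(w) − F(w')|² T_J(w, w') = B(w, w') T_J(w, w') − 𝒦(w, w')`, where `T_J` is the heat kernel,
`B = covKernel` the covariance kernel and `𝒦 = dcKernel` the (positive-definite) Gram kernel of the
double-commutator features. This is the pointwise, operator-free form of Borgs–Seiler's expansion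
of the double commutator `[L̄, [L, T]]` (1983, (III.33)–(III.53)): the positive-definite remainder
is what reflection positivity discards, the covariance kernel is the sum over "broken" Polyakov
loops. [cite: BorgsSeiler1983, §III.2 (III.33)–(III.53) (pp. 349–352)] -/
theorem dcKernel_identity (hJ : J ≠ 0) (hF : Continuous F) {C : ℝ} {n : ℕ} (hC : 0 ≤ C)
    (hFb : ∀ v, ‖F v‖ ≤ C * (1 + ‖v‖) ^ n)
    (hmv : ∀ w, ∫ η, F (w + (J : ℝ)⁻¹ • η) ∂gaussianPi ι J = F w) (w w' : ι → ℝ) :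
    ((Complex.normSq (F w - F w') : ℝ) : ℂ) * heatKernel J w w' =
      covKernel J F w w' * heatKernel J w w' - dcKernel J F w w' := by
  have hJ' : (J : ℝ) ≠ 0 := by exact_mod_cast hJ
  -- Step 1: the Gram kernel as a tilted Gaussian integral
  set c : ι → ℝ := w + w' with hc
  set K : ℝ := Real.exp (-((J : ℝ) * ∑ i, w i ^ 2) - (J : ℝ) * ∑ i, w' i ^ 2) with hK
  set G : (ι → ℝ) → ℂ := fun η =>
    conj (F w - F ((J : ℝ)⁻¹ • η - w)) * (F w' - F ((J : ℝ)⁻¹ • η - w')) with hG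
  have hGm : AEStronglyMeasurable G (gaussianPi ι J) := by
    have h1 : Continuous fun η : ι → ℝ => F ((J : ℝ)⁻¹ • η - w) := hF.comp (by fun_prop)
    have h2 : Continuous fun η : ι → ℝ => F ((J : ℝ)⁻¹ • η - w') := hF.comp (by fun_prop)
    exact ((Complex.continuous_conj.comp (continuous_const.sub h1)).mul
      (continuous_const.sub h2)).aestronglyMeasurable
  have hintegrand : ∀ η : ι → ℝ, conj (dcFeature J F η w) * dcFeature J F η w' =
      Real.exp (∑ i, c i * η i) • ((K : ℂ) * G η) := by
    intro η
    have hreal : gaussFeature J η w * gaussFeature J η w' = Real.exp (∑ i, c i * η i) * K := by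
      simp only [gaussFeature, hK, ← Real.exp_add, hc, Pi.add_apply]
      congr 1
      have : ∑ i, (w i + w' i) * η i = ∑ i, η i * w i + ∑ i, η i * w' i := by
        rw [← Finset.sum_add_distrib]; exact Finset.sum_congr rfl fun i _ => by ring
      rw [this]; ring
    simp only [dcFeature, map_mul, Complex.conj_ofReal, hG, Complex.real_smul]
    have : (gaussFeature J η w : ℂ) * (gaussFeature J η w' : ℂ) =
        (Real.exp (∑ i, c i * η i) : ℂ) * (K : ℂ) := by
      rw [← Complex.ofReal_mul, hreal, Complex.ofReal_mul]
    calc conj (F w - F ((J : ℝ)⁻¹ • η - w)) * (gaussFeature J η w : ℂ) *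
          ((F w' - F ((J : ℝ)⁻¹ • η - w')) * (gaussFeature J η w' : ℂ))
        = ((gaussFeature J η w : ℂ) * (gaussFeature J η w' : ℂ)) *
            (conj (F w - F ((J : ℝ)⁻¹ • η - w)) * (F w' - F ((J : ℝ)⁻¹ • η - w'))) := by ring
      _ = _ := by rw [this]; ring
  have hstep1 : dcKernel J F w w' =
      Real.exp ((J : ℝ) * (∑ i, c i ^ 2) / 2) • ∫ η, (K : ℂ) * G (η + (J : ℝ) • c) ∂gaussianPi ι J := by
    unfold dcKernel
    simp_rw [hintegrand]
    exact integral_exp_inner_smul_gaussianPi J c (fun η => (K : ℂ) * G η)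
      (aestronglyMeasurable_const.mul hGm)
  -- Step 2: the shifted integrand
  have hshift : ∀ η : ι → ℝ, G (η + (J : ℝ) • c) =
      conj (F w - F (w' + (J : ℝ)⁻¹ • η)) * (F w' - F (w + (J : ℝ)⁻¹ • η)) := by
    intro η
    simp only [hG, hc]
    rw [inv_smul_add_smul_sub hJ' w w' η, add_comm w w', inv_smul_add_smul_sub hJ' w' w η]
  -- Step 3: evaluate the Gaussian integral using the mean-value property
  have hIa := integrable_apply_add (J := J) hF hC hFb w
  have hIb := integrable_apply_add (J := J) hF hC hFb w'
  have hIab : Integrable (fun η => conj (F (w' + (J : ℝ)⁻¹ • η)) * F (w + (J : ℝ)⁻¹ • η))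
      (gaussianPi ι J) := integrable_conj_mul (J := J) hF hC hFb w' w
  have hmvconj : ∫ η, conj (F (w' + (J : ℝ)⁻¹ • η)) ∂gaussianPi ι J = conj (F w') := by
    rw [integral_conj, hmv w']
  have hint : ∫ η, G (η + (J : ℝ) • c) ∂gaussianPi ι J =
      conj (F w) * F w' - conj (F w) * F w - conj (F w') * F w' +
        ∫ η, conj (F (w' + (J : ℝ)⁻¹ • η)) * F (w + (J : ℝ)⁻¹ • η) ∂gaussianPi ι J := by
    simp_rw [hshift]
    have hexp : ∀ η : ι → ℝ, conj (F w - F (w' + (J : ℝ)⁻¹ • η)) * (F w' - F (w + (J : ℝ)⁻¹ • η)) =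
        conj (F w) * F w' - conj (F w) * F (w + (J : ℝ)⁻¹ • η)
          - conj (F (w' + (J : ℝ)⁻¹ • η)) * F w'
          + conj (F (w' + (J : ℝ)⁻¹ • η)) * F (w + (J : ℝ)⁻¹ • η) := fun η => by
      rw [map_sub]; ring
    simp_rw [hexp]
    have hI1 : Integrable (fun _ : ι → ℝ => conj (F w) * F w') (gaussianPi ι J) := integrable_const _
    have hI2 : Integrable (fun η => conj (F w) * F (w + (J : ℝ)⁻¹ • η)) (gaussianPi ι J) :=
      hIa.const_mul _
    have hIbc : Integrable (fun η => conj (F (w' + (J : ℝ)⁻¹ • η))) (gaussianPi ι J) :=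
      (Complex.conjCLE : ℂ →L[ℝ] ℂ).integrable_comp hIb
    have hI3 : Integrable (fun η => conj (F (w' + (J : ℝ)⁻¹ • η)) * F w') (gaussianPi ι J) :=
      hIbc.mul_const _
    have hI12 : Integrable (fun η => conj (F w) * F w' - conj (F w) * F (w + (J : ℝ)⁻¹ • η))
        (gaussianPi ι J) := hI1.sub hI2
    have hI123 : Integrable (fun η => conj (F w) * F w' - conj (F w) * F (w + (J : ℝ)⁻¹ • η)
        - conj (F (w' + (J : ℝ)⁻¹ • η)) * F w') (gaussianPi ι J) := hI12.sub hI3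
    rw [integral_add hI123 hIab, integral_sub hI12 hI3,
      integral_sub hI1 hI2, integral_const, probReal_univ, one_smul, integral_const_mul, hmv w,
      integral_mul_const, hmvconj]
  -- Step 4: assemble
  have hT : Real.exp ((J : ℝ) * (∑ i, c i ^ 2) / 2) * K = heatKernel J w w' := by
    rw [hK, ← Real.exp_add, heatKernel]
    congr 1
    have h1 : ∑ i, (w i - w' i) ^ 2 = ∑ i, w i ^ 2 + ∑ i, w' i ^ 2 - 2 * ∑ i, w i * w' i := by
      rw [Finset.mul_sum, ← Finset.sum_add_distrib, ← Finset.sum_sub_distrib]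
      exact Finset.sum_congr rfl fun i _ => by ring
    have h2 : ∑ i, c i ^ 2 = ∑ i, w i ^ 2 + ∑ i, w' i ^ 2 + 2 * ∑ i, w i * w' i := by
      rw [Finset.mul_sum, ← Finset.sum_add_distrib, ← Finset.sum_add_distrib]
      exact Finset.sum_congr rfl fun i _ => by simp only [hc, Pi.add_apply]; ring
    rw [h1, h2]; ring
  rw [hstep1, integral_const_mul, hint, Complex.real_smul, covKernel]
  have hTc : ((Real.exp ((J : ℝ) * (∑ i, c i ^ 2) / 2) : ℝ) : ℂ) * (K : ℂ) = (heatKernel J w w' : ℂ) := by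
    rw [← Complex.ofReal_mul, hT]
  rw [Complex.normSq_eq_conj_mul_self, map_sub, ← hTc]
  ring

/-! ## Polyakov-type traces: products of independent Gaussian matrix layers

The function `F` of the lattice application: for a finite set `X` of transverse sites, `L₀`
layers and `N × N` complex matrices, the real coordinate space is
`PIdx X L₀ N = X × Fin L₀ × Fin N × Fin N × Fin 2 → ℝ` (real and imaginary parts of the matrix
entries), `matOf v x m` is the matrix of layer `m` at site `x`, `layerProd v x k` the ordered
product of the first `k` layers, `polyTrace v x = tr ∏_{m < L₀} matOf v x m` (a Polyakov loop when
the layers are the time-like link variables at `x`) and `smearedPoly h v = Σ_x h x · polyTrace v x`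
the transversally smeared loop. Under `γ = gaussianPi _ J` the matrices `matOf η x m` are
independent complex Gaussian matrices with `E η_ab = 0`, `E η_ab conj η_cd = 2J δ_ac δ_bd`. -/

section Polyakov

variable {X : Type*} {L₀ N : ℕ}

/-- Real coordinates of `X × L₀` complex `N × N` matrices: site, layer, row, column, re/im. [folklore] -/
abbrev PIdx (X : Type*) (L₀ N : ℕ) : Type _ := X × Fin L₀ × Fin N × Fin N × Fin 2

/-- The complex `N × N` matrix of layer `m` at site `x` encoded in `v`. [folklore] -/
def matOf (v : PIdx X L₀ N → ℝ) (x : X) (m : Fin L₀) : Matrix (Fin N) (Fin N) ℂ :=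
  fun a b => ⟨v (x, m, a, b, 0), v (x, m, a, b, 1)⟩

/-- `matOf` is additive. [folklore] -/
theorem matOf_add (v v' : PIdx X L₀ N → ℝ) (x : X) (m : Fin L₀) :
    matOf (v + v') x m = matOf v x m + matOf v' x m := by
  ext a b
  apply Complex.ext <;> simp [matOf]

/-- `matOf` is homogeneous. [folklore] -/
theorem matOf_smul (r : ℝ) (v : PIdx X L₀ N → ℝ) (x : X) (m : Fin L₀) :
    matOf (r • v) x m = (r : ℂ) • matOf v x m := by
  ext a b
  apply Complex.ext <;> simp [matOf]

/-- The real coordinates of a family of complex matrices (inverse of `matOf`). [folklore] -/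
def realify (M : X → Fin L₀ → Matrix (Fin N) (Fin N) ℂ) : PIdx X L₀ N → ℝ :=
  fun i => if i.2.2.2.2 = 0 then (M i.1 i.2.1 i.2.2.1 i.2.2.2.1).re else (M i.1 i.2.1 i.2.2.1 i.2.2.2.1).im

/-- `matOf (realify M) = M`. [folklore] -/
@[simp] theorem matOf_realify (M : X → Fin L₀ → Matrix (Fin N) (Fin N) ℂ) (x : X) (m : Fin L₀) :
    matOf (realify M) x m = M x m := by
  ext a b
  apply Complex.ext <;> simp [matOf, realify]

variable [Fintype X]

/-- The squared coordinate distance of two realified families is the sum of the squared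
Frobenius distances: `Σᵢ (vᵢ − v'ᵢ)² = Σ_{x,m,a,b} |M_{ab} − M'_{ab}|²`. [folklore] -/
theorem sum_sq_realify_sub (M M' : X → Fin L₀ → Matrix (Fin N) (Fin N) ℂ) :
    ∑ i, (realify M i - realify M' i) ^ 2 =
      ∑ x, ∑ m, ∑ a, ∑ b, Complex.normSq (M x m a b - M' x m a b) := by
  simp only [Fintype.sum_prod_type, Fin.sum_univ_two, Complex.normSq_apply, realify, Fin.isValue,
    if_true, one_ne_zero, if_false, Complex.sub_re, Complex.sub_im]
  refine Finset.sum_congr rfl fun x _ => Finset.sum_congr rfl fun m _ =>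
    Finset.sum_congr rfl fun a _ => Finset.sum_congr rfl fun b _ => by ring

/-- Entries of `matOf v` are bounded by `2‖v‖` (sup norm). [folklore] -/
theorem norm_matOf_apply_le (v : PIdx X L₀ N → ℝ) (x : X) (m : Fin L₀) (a b : Fin N) :
    ‖matOf v x m a b‖ ≤ 2 * ‖v‖ := by
  have h0 : |v (x, m, a, b, 0)| ≤ ‖v‖ := by
    have := norm_le_pi_norm v (x, m, a, b, 0); rwa [Real.norm_eq_abs] at this
  have h1 : |v (x, m, a, b, 1)| ≤ ‖v‖ := by
    have := norm_le_pi_norm v (x, m, a, b, 1); rwa [Real.norm_eq_abs] at this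
  calc ‖matOf v x m a b‖ ≤ |(matOf v x m a b).re| + |(matOf v x m a b).im| :=
        Complex.norm_le_abs_re_add_abs_im _
    _ = |v (x, m, a, b, 0)| + |v (x, m, a, b, 1)| := rfl
    _ ≤ 2 * ‖v‖ := by linarith

omit [Fintype X] in
/-- Each entry of `matOf` depends continuously on the coordinates. [folklore] -/
theorem continuous_matOf_apply (x : X) (m : Fin L₀) (a b : Fin N) :
    Continuous fun v : PIdx X L₀ N → ℝ => matOf v x m a b := by
  have h : (fun v : PIdx X L₀ N → ℝ => matOf v x m a b) =
      fun v => Complex.equivRealProdCLM.symm (v (x, m, a, b, 0), v (x, m, a, b, 1)) := by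
    funext v; rfl
  rw [h]
  exact Complex.equivRealProdCLM.symm.continuous.comp
    ((continuous_apply _).prodMk (continuous_apply _))

/-- The ordered product `Q_k = ∏_{m < k} matOf v x m` of the first `k` layers at site `x`
(`Q_0 = 1`, `Q_{k+1} = Q_k · matOf v x k`; for `k ≥ L₀` no further factors). [folklore] -/
def layerProd (v : PIdx X L₀ N → ℝ) (x : X) : ℕ → Matrix (Fin N) (Fin N) ℂ
  | 0 => 1
  | k + 1 => layerProd v x k * (if h : k < L₀ then matOf v x ⟨k, h⟩ else 1)

omit [Fintype X] in
/-- `Q_0 = 1`. [folklore] -/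
@[simp] theorem layerProd_zero (v : PIdx X L₀ N → ℝ) (x : X) : layerProd v x 0 = 1 := rfl

omit [Fintype X] in
/-- The recursion `Q_{k+1} = Q_k · M_k` for `k < L₀`. [folklore] -/
theorem layerProd_succ (v : PIdx X L₀ N → ℝ) (x : X) {k : ℕ} (hk : k < L₀) :
    layerProd v x (k + 1) = layerProd v x k * matOf v x ⟨k, hk⟩ := by
  simp [layerProd, hk]

/-- The Polyakov-type trace `P_x(v) = tr ∏_{m < L₀} matOf v x m`. [folklore] -/
def polyTrace (v : PIdx X L₀ N → ℝ) (x : X) : ℂ :=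
  (layerProd v x L₀).trace

/-- The transversally smeared trace `F_h(v) = Σ_x h(x) P_x(v)`. [folklore] -/
def smearedPoly (h : X → ℂ) (v : PIdx X L₀ N → ℝ) : ℂ :=
  ∑ x, h x * polyTrace v x

/-! ### Continuity and polynomial growth -/

omit [Fintype X] in
/-- Entries of `Q_k` are continuous in the coordinates. [folklore] -/
theorem continuous_layerProd_apply (x : X) (k : ℕ) (a b : Fin N) :
    Continuous fun v : PIdx X L₀ N → ℝ => layerProd v x k a b := by
  induction k generalizing a b with
  | zero => simp only [layerProd_zero]; exact continuous_const
  | succ k ih =>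
      by_cases hk : k < L₀
      · simp only [layerProd, hk, dite_true, Matrix.mul_apply]
        exact continuous_finsetSum _ fun c _ => (ih a c).mul (continuous_matOf_apply x _ c b)
      · simp only [layerProd, hk, dite_false, Matrix.mul_one]
        exact ih a b

omit [Fintype X] in
/-- `polyTrace · x` is continuous. [folklore] -/
theorem continuous_polyTrace (x : X) : Continuous fun v : PIdx X L₀ N → ℝ => polyTrace v x := by
  unfold polyTrace Matrix.trace
  exact continuous_finsetSum _ fun a _ => by
    simpa [Matrix.diag] using continuous_layerProd_apply (L₀ := L₀) x L₀ a a

/-- `smearedPoly h` is continuous. [folklore] -/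
theorem continuous_smearedPoly (h : X → ℂ) :
    Continuous fun v : PIdx X L₀ N → ℝ => smearedPoly h v :=
  continuous_finsetSum _ fun x _ => continuous_const.mul (continuous_polyTrace x)

/-- Entries of `Q_k` grow at most like `(2N(1 + ‖v‖))^k`. [folklore] -/
theorem norm_layerProd_apply_le (v : PIdx X L₀ N → ℝ) (x : X) (k : ℕ) (a b : Fin N) :
    ‖layerProd v x k a b‖ ≤ (2 * N * (1 + ‖v‖)) ^ k := by
  induction k generalizing a b with
  | zero =>
      simp only [layerProd_zero, pow_zero]
      by_cases hab : a = b
      · subst hab; simp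
      · simp [Matrix.one_apply_ne hab]
  | succ k ih =>
      by_cases hk : k < L₀
      · rw [layerProd_succ v x hk, Matrix.mul_apply]
        calc ‖∑ c, layerProd v x k a c * matOf v x ⟨k, hk⟩ c b‖
            ≤ ∑ c, ‖layerProd v x k a c * matOf v x ⟨k, hk⟩ c b‖ := norm_sum_le _ _
          _ ≤ ∑ _c : Fin N, (2 * N * (1 + ‖v‖)) ^ k * (2 * (1 + ‖v‖)) :=
              Finset.sum_le_sum fun c _ => by
                rw [norm_mul]
                refine mul_le_mul (ih a c) ?_ (norm_nonneg _) (by positivity)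
                have := norm_matOf_apply_le v x ⟨k, hk⟩ c b
                nlinarith [norm_nonneg v]
          _ = (2 * N * (1 + ‖v‖)) ^ (k + 1) := by
              rw [Finset.sum_const, Finset.card_univ, Fintype.card_fin, nsmul_eq_mul, pow_succ]
              ring
      · have hsucc : layerProd v x (k + 1) = layerProd v x k := by simp [layerProd, hk]
        rw [hsucc]
        calc ‖layerProd v x k a b‖ ≤ (2 * N * (1 + ‖v‖)) ^ k := ih a b
          _ ≤ (2 * N * (1 + ‖v‖)) ^ (k + 1) := by
              rcases Nat.eq_zero_or_pos N with hN | hN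
              · subst hN; exact (Fin.elim0 a)
              · refine pow_le_pow_right₀ ?_ (Nat.le_succ k)
                have : (1 : ℝ) ≤ N := by exact_mod_cast hN
                nlinarith [norm_nonneg v]

/-- Polynomial growth of `polyTrace`: `‖P_x(v)‖ ≤ N (2N)^{L₀} (1 + ‖v‖)^{L₀}`. [folklore] -/
theorem norm_polyTrace_le (v : PIdx X L₀ N → ℝ) (x : X) :
    ‖polyTrace v x‖ ≤ N * (2 * N) ^ L₀ * (1 + ‖v‖) ^ L₀ := by
  unfold polyTrace Matrix.trace
  calc ‖∑ a, Matrix.diag (layerProd v x L₀) a‖ ≤ ∑ a, ‖Matrix.diag (layerProd v x L₀) a‖ :=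
        norm_sum_le _ _
    _ ≤ ∑ _a : Fin N, (2 * N * (1 + ‖v‖)) ^ L₀ :=
        Finset.sum_le_sum fun a _ => norm_layerProd_apply_le v x L₀ a a
    _ = N * (2 * N) ^ L₀ * (1 + ‖v‖) ^ L₀ := by
        rw [Finset.sum_const, Finset.card_univ, Fintype.card_fin, nsmul_eq_mul, mul_pow]; ring

/-- Polynomial growth of `smearedPoly`. [folklore] -/
theorem norm_smearedPoly_le (h : X → ℂ) (v : PIdx X L₀ N → ℝ) :
    ‖smearedPoly h v‖ ≤ ((∑ x, ‖h x‖) * (N * (2 * N) ^ L₀)) * (1 + ‖v‖) ^ L₀ := by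
  unfold smearedPoly
  calc ‖∑ x, h x * polyTrace v x‖ ≤ ∑ x, ‖h x * polyTrace v x‖ := norm_sum_le _ _
    _ ≤ ∑ x, ‖h x‖ * (N * (2 * N) ^ L₀ * (1 + ‖v‖) ^ L₀) :=
        Finset.sum_le_sum fun x _ => by
          rw [norm_mul]
          exact mul_le_mul_of_nonneg_left (norm_polyTrace_le v x) (norm_nonneg _)
    _ = ((∑ x, ‖h x‖) * (N * (2 * N) ^ L₀)) * (1 + ‖v‖) ^ L₀ := by
        rw [← Finset.sum_mul]; ring

/-! ### Polynomial growth (a convenience predicate) -/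

/-- `g` is continuous of polynomial growth on `ℝ^ι`. [folklore] -/
def PolyGrowth {ι : Type*} [Fintype ι] (g : (ι → ℝ) → ℂ) : Prop :=
  Continuous g ∧ ∃ C : ℝ, ∃ n : ℕ, ∀ η, ‖g η‖ ≤ C * (1 + ‖η‖) ^ n

namespace PolyGrowth

variable {ι : Type*} [Fintype ι] {g g' : (ι → ℝ) → ℂ}

/-- Functions of polynomial growth are `γ`-integrable. [folklore] -/
theorem integrable (hg : PolyGrowth g) (J : ℝ≥0) : Integrable g (gaussianPi ι J) := by
  obtain ⟨hc, C, n, hb⟩ := hg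
  exact integrable_of_norm_le_pow_gaussianPi J hc.aestronglyMeasurable hb

/-- Continuity. [folklore] -/
theorem continuous (hg : PolyGrowth g) : Continuous g := hg.1

/-- Measurability. [folklore] -/
theorem measurable (hg : PolyGrowth g) : Measurable g := hg.1.measurable

/-- Constants have polynomial growth. [folklore] -/
theorem const (c : ℂ) : PolyGrowth (fun _ : ι → ℝ => c) :=
  ⟨continuous_const, ‖c‖, 0, fun η => by simp⟩

/-- Closure under products. [folklore] -/
theorem mul (hg : PolyGrowth g) (hg' : PolyGrowth g') : PolyGrowth (fun η => g η * g' η) := by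
  obtain ⟨hc, C, n, hb⟩ := hg
  obtain ⟨hc', C', n', hb'⟩ := hg'
  refine ⟨hc.mul hc', |C| * |C'|, n + n', fun η => ?_⟩
  rw [norm_mul, pow_add]
  have h1 : ‖g η‖ ≤ |C| * (1 + ‖η‖) ^ n :=
    (hb η).trans (mul_le_mul_of_nonneg_right (le_abs_self C) (by positivity))
  have h2 : ‖g' η‖ ≤ |C'| * (1 + ‖η‖) ^ n' :=
    (hb' η).trans (mul_le_mul_of_nonneg_right (le_abs_self C') (by positivity))
  calc ‖g η‖ * ‖g' η‖ ≤ (|C| * (1 + ‖η‖) ^ n) * (|C'| * (1 + ‖η‖) ^ n') :=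
        mul_le_mul h1 h2 (norm_nonneg _) (by positivity)
    _ = |C| * |C'| * ((1 + ‖η‖) ^ n * (1 + ‖η‖) ^ n') := by ring

/-- Closure under sums. [folklore] -/
theorem add (hg : PolyGrowth g) (hg' : PolyGrowth g') : PolyGrowth (fun η => g η + g' η) := by
  obtain ⟨hc, C, n, hb⟩ := hg
  obtain ⟨hc', C', n', hb'⟩ := hg'
  refine ⟨hc.add hc', |C| + |C'|, n + n', fun η => ?_⟩
  have h1 : ‖g η‖ ≤ |C| * (1 + ‖η‖) ^ (n + n') := by
    refine (hb η).trans ((mul_le_mul_of_nonneg_right (le_abs_self C) (by positivity)).trans ?_)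
    refine mul_le_mul_of_nonneg_left ?_ (abs_nonneg C)
    exact pow_le_pow_right₀ (by linarith [norm_nonneg η]) (Nat.le_add_right n n')
  have h2 : ‖g' η‖ ≤ |C'| * (1 + ‖η‖) ^ (n + n') := by
    refine (hb' η).trans ((mul_le_mul_of_nonneg_right (le_abs_self C') (by positivity)).trans ?_)
    refine mul_le_mul_of_nonneg_left ?_ (abs_nonneg C')
    exact pow_le_pow_right₀ (by linarith [norm_nonneg η]) (Nat.le_add_left n' n)
  calc ‖g η + g' η‖ ≤ ‖g η‖ + ‖g' η‖ := norm_add_le _ _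
    _ ≤ |C| * (1 + ‖η‖) ^ (n + n') + |C'| * (1 + ‖η‖) ^ (n + n') := add_le_add h1 h2
    _ = (|C| + |C'|) * (1 + ‖η‖) ^ (n + n') := by ring

/-- Closure under complex conjugation. [folklore] -/
theorem cconj (hg : PolyGrowth g) : PolyGrowth (fun η => conj (g η)) := by
  obtain ⟨hc, C, n, hb⟩ := hg
  exact ⟨Complex.continuous_conj.comp hc, C, n, fun η => by rw [Complex.norm_conj]; exact hb η⟩

/-- Closure under finite sums. [folklore] -/
theorem sum {α : Type*} (s : Finset α) {f : α → (ι → ℝ) → ℂ} (hf : ∀ a ∈ s, PolyGrowth (f a)) :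
    PolyGrowth (fun η => ∑ a ∈ s, f a η) := by
  classical
  induction s using Finset.induction_on with
  | empty => simpa using const (ι := ι) 0
  | insert a s has ih =>
      have h := (hf a (Finset.mem_insert_self a s)).add (ih fun b hb => hf b (Finset.mem_insert_of_mem hb))
      refine ⟨?_, ?_⟩
      · simpa [Finset.sum_insert has] using h.1
      · obtain ⟨C, n, hb⟩ := h.2
        exact ⟨C, n, fun η => by simpa [Finset.sum_insert has] using hb η⟩

end PolyGrowth

/-! ### Polynomial growth of the shifted matrix functions -/

variable (J : ℝ≥0)

omit [Fintype X] in
/-- The layer matrices of the shifted point `w + η/J` split as `W + J⁻¹ H`. [folklore] -/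
theorem matOf_shift (w η : PIdx X L₀ N → ℝ) (x : X) (m : Fin L₀) :
    matOf (w + (J : ℝ)⁻¹ • η) x m = matOf w x m + ((J : ℝ)⁻¹ : ℂ) • matOf η x m := by
  rw [matOf_add, matOf_smul]; norm_cast

variable {J}

/-- Entries of `matOf η` have polynomial (linear) growth. [folklore] -/
theorem polyGrowth_matOf_apply (x : X) (m : Fin L₀) (a b : Fin N) :
    PolyGrowth (fun η : PIdx X L₀ N → ℝ => matOf η x m a b) :=
  ⟨continuous_matOf_apply x m a b, 2, 1, fun η => by
    have := norm_matOf_apply_le η x m a b; nlinarith [norm_nonneg η]⟩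

/-- Entries of `matOf (w + η/J)` have polynomial growth in `η`. [folklore] -/
theorem polyGrowth_matOf_shift_apply (w : PIdx X L₀ N → ℝ) (x : X) (m : Fin L₀) (a b : Fin N) :
    PolyGrowth (fun η : PIdx X L₀ N → ℝ => matOf (w + (J : ℝ)⁻¹ • η) x m a b) := by
  have h : (fun η : PIdx X L₀ N → ℝ => matOf (w + (J : ℝ)⁻¹ • η) x m a b) =
      fun η => matOf w x m a b + ((J : ℝ)⁻¹ : ℂ) * matOf η x m a b := by
    funext η; rw [matOf_shift]; simp [Matrix.add_apply, Matrix.smul_apply, smul_eq_mul]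
  rw [h]
  exact (PolyGrowth.const _).add ((PolyGrowth.const _).mul (polyGrowth_matOf_apply x m a b))

/-- Entries of `Q_k(w + η/J)` have polynomial growth in `η`. [folklore] -/
theorem polyGrowth_layerProd_shift_apply (w : PIdx X L₀ N → ℝ) (x : X) (k : ℕ) (a b : Fin N) :
    PolyGrowth (fun η : PIdx X L₀ N → ℝ => layerProd (w + (J : ℝ)⁻¹ • η) x k a b) := by
  induction k generalizing a b with
  | zero => simp only [layerProd_zero]; exact PolyGrowth.const _
  | succ k ih =>
      by_cases hk : k < L₀
      · simp only [layerProd, hk, dite_true, Matrix.mul_apply]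
        exact PolyGrowth.sum _ fun c _ => (ih a c).mul (polyGrowth_matOf_shift_apply w x _ c b)
      · simp only [layerProd, hk, dite_false, Matrix.mul_one]
        exact ih a b

/-- `P_x(w + η/J)` has polynomial growth in `η`. [folklore] -/
theorem polyGrowth_polyTrace_shift (w : PIdx X L₀ N → ℝ) (x : X) :
    PolyGrowth (fun η : PIdx X L₀ N → ℝ => polyTrace (w + (J : ℝ)⁻¹ • η) x) := by
  unfold polyTrace Matrix.trace
  exact PolyGrowth.sum _ fun a _ => by
    simpa [Matrix.diag] using polyGrowth_layerProd_shift_apply (J := J) w x L₀ a a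

/-- `F_h(w + η/J)` has polynomial growth in `η`. [folklore] -/
theorem polyGrowth_smearedPoly_shift (h : X → ℂ) (w : PIdx X L₀ N → ℝ) :
    PolyGrowth (fun η : PIdx X L₀ N → ℝ => smearedPoly h (w + (J : ℝ)⁻¹ • η)) :=
  PolyGrowth.sum _ fun x _ => (PolyGrowth.const _).mul (polyGrowth_polyTrace_shift w x)

/-! ### Dependence on coordinate blocks -/

/-- The coordinates of the layers `< k` at site `x`. [folklore] -/
def lowerBlock [DecidableEq X] (x : X) (k : ℕ) : Finset (PIdx X L₀ N) :=
  Finset.univ.filter fun i => i.1 = x ∧ i.2.1.val < k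

/-- The coordinates of layer `m` at site `x`. [folklore] -/
def layerBlock [DecidableEq X] (x : X) (m : Fin L₀) : Finset (PIdx X L₀ N) :=
  Finset.univ.filter fun i => i.1 = x ∧ i.2.1 = m

/-- The two real coordinates of the entry `(a, b)` of layer `m` at site `x`. [folklore] -/
def entryBlock [DecidableEq X] (x : X) (m : Fin L₀) (a b : Fin N) : Finset (PIdx X L₀ N) :=
  Finset.univ.filter fun i => i.1 = x ∧ i.2.1 = m ∧ i.2.2.1 = a ∧ i.2.2.2.1 = b

/-- The coordinates at site `x`. [folklore] -/
def siteBlock [DecidableEq X] (x : X) : Finset (PIdx X L₀ N) :=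
  Finset.univ.filter fun i => i.1 = x

variable [DecidableEq X]

/-- The lower block and the current layer are disjoint. [folklore] -/
theorem disjoint_lowerBlock_layerBlock (x : X) {k : ℕ} (hk : k < L₀) :
    Disjoint (lowerBlock (N := N) x k) (layerBlock (N := N) x ⟨k, hk⟩) := by
  rw [Finset.disjoint_left]
  rintro ⟨y, m, a, b, r⟩ h1 h2
  simp only [lowerBlock, layerBlock, Finset.mem_filter, Finset.mem_univ, true_and] at h1 h2
  have := h2.2
  rw [this] at h1
  exact lt_irrefl _ h1.2

/-- Entry blocks of distinct entries are disjoint. [folklore] -/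
theorem disjoint_entryBlock (x : X) (m : Fin L₀) {a b c d : Fin N} (h : (a, b) ≠ (c, d)) :
    Disjoint (entryBlock (X := X) x m a b) (entryBlock x m c d) := by
  rw [Finset.disjoint_left]
  rintro ⟨y, m', a', b', r⟩ h1 h2
  simp only [entryBlock, Finset.mem_filter, Finset.mem_univ, true_and] at h1 h2
  apply h
  rw [← h1.2.2.1, ← h1.2.2.2, h2.2.2.1, h2.2.2.2]

/-- Distinct sites have disjoint blocks. [folklore] -/
theorem disjoint_siteBlock {x y : X} (hxy : x ≠ y) :
    Disjoint (siteBlock (L₀ := L₀) (N := N) x) (siteBlock y) := by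
  rw [Finset.disjoint_left]
  rintro ⟨z, m, a, b, r⟩ h1 h2
  simp only [siteBlock, Finset.mem_filter, Finset.mem_univ, true_and] at h1 h2
  exact hxy (h1.symm.trans h2)

omit [Fintype X] [DecidableEq X] in
/-- An entry of `matOf η x m` depends only on its two real coordinates. [folklore] -/
theorem matOf_apply_eq_of_eq {η η' : PIdx X L₀ N → ℝ} {x : X} {m : Fin L₀} {a b : Fin N}
    (h0 : η (x, m, a, b, 0) = η' (x, m, a, b, 0)) (h1 : η (x, m, a, b, 1) = η' (x, m, a, b, 1)) :
    matOf η x m a b = matOf η' x m a b := by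
  apply Complex.ext
  · exact h0
  · exact h1

/-- An entry of `matOf η` depends only on its entry block. [folklore] -/
theorem dependsOn_matOf_apply (x : X) (m : Fin L₀) (a b : Fin N) :
    DependsOn (fun η : PIdx X L₀ N → ℝ => matOf η x m a b) ((entryBlock x m a b : Finset (PIdx X L₀ N)) : Set (PIdx X L₀ N)) := by
  intro η η' h
  apply matOf_apply_eq_of_eq
  · exact h _ (by simp [entryBlock])
  · exact h _ (by simp [entryBlock])

/-- An entry of `matOf η x m` depends only on the layer block. [folklore] -/
theorem dependsOn_matOf_apply_layer (x : X) (m : Fin L₀) (a b : Fin N) :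
    DependsOn (fun η : PIdx X L₀ N → ℝ => matOf η x m a b) ((layerBlock x m : Finset (PIdx X L₀ N)) : Set (PIdx X L₀ N)) := by
  refine (dependsOn_matOf_apply x m a b).mono fun i hi => ?_
  simp only [Finset.mem_coe, entryBlock, layerBlock, Finset.mem_filter, Finset.mem_univ,
    true_and] at hi ⊢
  exact ⟨hi.1, hi.2.1⟩

/-- An entry of `matOf (w + η/J) x m` depends only on the layer block (of `η`). [folklore] -/
theorem dependsOn_matOf_shift_apply (w : PIdx X L₀ N → ℝ) (x : X) (m : Fin L₀) (a b : Fin N) :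
    DependsOn (fun η : PIdx X L₀ N → ℝ => matOf (w + (J : ℝ)⁻¹ • η) x m a b)
      ((layerBlock x m : Finset (PIdx X L₀ N)) : Set (PIdx X L₀ N)) := by
  intro η η' h
  simp only [matOf_shift, Matrix.add_apply, Matrix.smul_apply]
  have e : matOf η x m a b = matOf η' x m a b := dependsOn_matOf_apply_layer x m a b h
  rw [e]

/-- Entries of `Q_k(w + η/J)` depend only on the lower block (layers `< k` at site `x`).
[folklore] -/
theorem dependsOn_layerProd_shift_apply (w : PIdx X L₀ N → ℝ) (x : X) (k : ℕ) (a b : Fin N) :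
    DependsOn (fun η : PIdx X L₀ N → ℝ => layerProd (w + (J : ℝ)⁻¹ • η) x k a b)
      ((lowerBlock x k : Finset (PIdx X L₀ N)) : Set (PIdx X L₀ N)) := by
  induction k generalizing a b with
  | zero => intro η η' _; simp
  | succ k ih =>
      intro η η' h
      by_cases hk : k < L₀
      · simp only [layerProd, hk, dite_true, Matrix.mul_apply]
        refine Finset.sum_congr rfl fun c _ => ?_
        have hlow : ∀ i ∈ ((lowerBlock x k : Finset (PIdx X L₀ N)) : Set (PIdx X L₀ N)), η i = η' i :=
          fun i hi => h i (by
            simp only [Finset.mem_coe, lowerBlock, Finset.mem_filter, Finset.mem_univ, true_and]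
              at hi ⊢
            exact ⟨hi.1, Nat.lt_succ_of_lt hi.2⟩)
        have hlay : ∀ i ∈ ((layerBlock x ⟨k, hk⟩ : Finset (PIdx X L₀ N)) : Set (PIdx X L₀ N)), η i = η' i :=
          fun i hi => h i (by
            simp only [Finset.mem_coe, layerBlock, lowerBlock, Finset.mem_filter, Finset.mem_univ,
              true_and] at hi ⊢
            refine ⟨hi.1, ?_⟩
            rw [hi.2]; exact Nat.lt_succ_self k)
        have e1 : layerProd (w + (J : ℝ)⁻¹ • η) x k a c = layerProd (w + (J : ℝ)⁻¹ • η') x k a c :=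
          ih a c hlow
        have e2 : matOf (w + (J : ℝ)⁻¹ • η) x ⟨k, hk⟩ c b = matOf (w + (J : ℝ)⁻¹ • η') x ⟨k, hk⟩ c b :=
          dependsOn_matOf_shift_apply (J := J) w x ⟨k, hk⟩ c b hlay
        rw [e1, e2]
      · simp only [layerProd, hk, dite_false, Matrix.mul_one]
        exact ih a b fun i hi => h i (by
          simp only [Finset.mem_coe, lowerBlock, Finset.mem_filter, Finset.mem_univ, true_and]
            at hi ⊢
          exact ⟨hi.1, Nat.lt_succ_of_lt hi.2⟩)

/-- `P_x(w + η/J)` depends only on the site block of `x`. [folklore] -/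
theorem dependsOn_polyTrace_shift (w : PIdx X L₀ N → ℝ) (x : X) :
    DependsOn (fun η : PIdx X L₀ N → ℝ => polyTrace (w + (J : ℝ)⁻¹ • η) x)
      ((siteBlock x : Finset (PIdx X L₀ N)) : Set (PIdx X L₀ N)) := by
  intro η η' h
  unfold polyTrace Matrix.trace
  refine Finset.sum_congr rfl fun a _ => ?_
  simp only [Matrix.diag]
  exact dependsOn_layerProd_shift_apply (J := J) w x L₀ a a fun i hi => h i (by
    simp only [Finset.mem_coe, lowerBlock, siteBlock, Finset.mem_filter, Finset.mem_univ,
      true_and] at hi ⊢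
    exact hi.1)

/-! ### First and second moments of the Gaussian matrix entries -/

/-- `gaussianPi` is the product measure of the tree's RP mechanism (`piMeasure`). [folklore] -/
theorem gaussianPi_eq_piMeasure {ι : Type*} [Fintype ι] (J : ℝ≥0) :
    gaussianPi ι J = LatticeRP.piMeasure (ι := ι) (gaussianReal 0 J) := rfl

/-- The second moment of a coordinate: `∫ ηᵢ² dγ = J`. [folklore] -/
theorem integral_sq_eval_gaussianPi {ι : Type*} [Fintype ι] (J : ℝ≥0) (i : ι) :
    ∫ η, η i ^ 2 ∂gaussianPi ι J = J := by
  classical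
  have h := covariance_eval_gaussianPi J i i
  rw [if_pos rfl, covariance_self (measurable_pi_apply i).aemeasurable,
    variance_eq_integral (measurable_pi_apply i).aemeasurable] at h
  simpa [integral_eval_gaussianPi] using h

variable (J)

omit [DecidableEq X] in
/-- **First moment**: `∫ matOf η x m a b dγ(η) = 0`. [folklore] -/
theorem integral_matOf_apply (x : X) (m : Fin L₀) (a b : Fin N) :
    ∫ η, matOf η x m a b ∂gaussianPi (PIdx X L₀ N) J = 0 := by
  have hre : Integrable (fun η : PIdx X L₀ N → ℝ => η (x, m, a, b, 0)) (gaussianPi _ J) :=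
    (memLp_eval_gaussianPi J _ 1).integrable le_rfl
  have him : Integrable (fun η : PIdx X L₀ N → ℝ => η (x, m, a, b, 1)) (gaussianPi _ J) :=
    (memLp_eval_gaussianPi J _ 1).integrable le_rfl
  have h : (fun η : PIdx X L₀ N → ℝ => matOf η x m a b) =
      fun η => ((η (x, m, a, b, 0) : ℝ) : ℂ) + ((η (x, m, a, b, 1) : ℝ) : ℂ) * Complex.I := by
    funext η; apply Complex.ext <;> simp [matOf]
  rw [h, integral_add (hre.ofReal) (him.ofReal.mul_const _), integral_mul_const,
    integral_complex_ofReal, integral_complex_ofReal, integral_eval_gaussianPi,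
    integral_eval_gaussianPi]
  simp

omit [DecidableEq X] in
/-- **Second moment, diagonal**: `∫ |matOf η x m a b|² dγ = 2J`. [folklore] -/
theorem integral_normSq_matOf_apply (x : X) (m : Fin L₀) (a b : Fin N) :
    ∫ η, matOf η x m a b * conj (matOf η x m a b) ∂gaussianPi (PIdx X L₀ N) J =
      ((2 * (J : ℝ) : ℝ) : ℂ) := by
  have h : (fun η : PIdx X L₀ N → ℝ => matOf η x m a b * conj (matOf η x m a b)) =
      fun η => ((η (x, m, a, b, 0) ^ 2 + η (x, m, a, b, 1) ^ 2 : ℝ) : ℂ) := by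
    funext η
    rw [Complex.mul_conj, Complex.normSq_apply]
    simp [matOf, sq]
  have h0 : Integrable (fun η : PIdx X L₀ N → ℝ => η (x, m, a, b, 0) ^ 2) (gaussianPi _ J) := by
    simpa using (memLp_eval_gaussianPi J (x, m, a, b, (0 : Fin 2)) 2).integrable_norm_pow'
  have h1 : Integrable (fun η : PIdx X L₀ N → ℝ => η (x, m, a, b, 1) ^ 2) (gaussianPi _ J) := by
    simpa using (memLp_eval_gaussianPi J (x, m, a, b, (1 : Fin 2)) 2).integrable_norm_pow'
  rw [h, integral_complex_ofReal, integral_add h0 h1, integral_sq_eval_gaussianPi,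
    integral_sq_eval_gaussianPi]
  push_cast; ring

/-- **Second moment, off-diagonal**: distinct entries are orthogonal,
`∫ matOf η x m a b · conj (matOf η x m c d) dγ = 0` for `(a, b) ≠ (c, d)`. [folklore] -/
theorem integral_matOf_apply_mul_conj_of_ne (x : X) (m : Fin L₀) {a b c d : Fin N}
    (hne : (a, b) ≠ (c, d)) :
    ∫ η, matOf η x m a b * conj (matOf η x m c d) ∂gaussianPi (PIdx X L₀ N) J = 0 := by
  rw [gaussianPi_eq_piMeasure, LatticeRP.integral_mul_eq_of_dependsOn (gaussianReal 0 J)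
    (entryBlock x m a b) (entryBlock x m c d) (disjoint_entryBlock x m hne)
    (f := fun η => matOf η x m a b) (g := fun η => conj (matOf η x m c d))
    (continuous_matOf_apply x m a b).measurable
    (Complex.continuous_conj.comp (continuous_matOf_apply x m c d)).measurable
    (dependsOn_matOf_apply x m a b) (fun η η' h => by
      have e : matOf η x m c d = matOf η' x m c d := dependsOn_matOf_apply x m c d h
      show conj (matOf η x m c d) = conj (matOf η' x m c d)
      rw [e]),
    ← gaussianPi_eq_piMeasure, integral_matOf_apply]
  simp

/-- **Second moments** combined: `∫ matOf η x m a b · conj (matOf η x m c d) dγ = 2J [a = c][b = d]`.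
[folklore] -/
theorem integral_matOf_apply_mul_conj (x : X) (m : Fin L₀) (a b c d : Fin N) :
    ∫ η, matOf η x m a b * conj (matOf η x m c d) ∂gaussianPi (PIdx X L₀ N) J =
      ((if a = c ∧ b = d then 2 * (J : ℝ) else 0 : ℝ) : ℂ) := by
  split_ifs with h
  · obtain ⟨rfl, rfl⟩ := h
    exact integral_normSq_matOf_apply J x m a b
  · rw [Complex.ofReal_zero]
    exact integral_matOf_apply_mul_conj_of_ne J x m (by
      intro heq; apply h; injection heq with h1 h2; exact ⟨h1, h2⟩)

/-! ### Independence of the current layer from the lower layers -/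

variable {J}

/-- A function of polynomial growth depending only on the layers `< k` at `x` is independent of
the layer `k`: first-moment form `∫ g · H_ab = 0`. [folklore] -/
theorem integral_mul_matOf_apply_of_dependsOn {g : (PIdx X L₀ N → ℝ) → ℂ} (hg : PolyGrowth g)
    (x : X) {k : ℕ} (hk : k < L₀) (hgd : DependsOn g ((lowerBlock x k : Finset (PIdx X L₀ N)) : Set (PIdx X L₀ N))) (a b : Fin N) :
    ∫ η, g η * matOf η x ⟨k, hk⟩ a b ∂gaussianPi (PIdx X L₀ N) J = 0 := by
  rw [gaussianPi_eq_piMeasure, LatticeRP.integral_mul_eq_of_dependsOn (gaussianReal 0 J)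
    (lowerBlock x k) (layerBlock x ⟨k, hk⟩) (disjoint_lowerBlock_layerBlock x hk)
    (f := g) (g := fun η => matOf η x ⟨k, hk⟩ a b) hg.measurable
    (continuous_matOf_apply x _ a b).measurable hgd (dependsOn_matOf_apply_layer x _ a b),
    ← gaussianPi_eq_piMeasure, integral_matOf_apply, mul_zero]

/-- Same, second-moment form: `∫ g · H_ab conj H_cd = (∫ g) · 2J [a = c][b = d]`. [folklore] -/
theorem integral_mul_matOf_apply_mul_conj_of_dependsOn {g : (PIdx X L₀ N → ℝ) → ℂ}
    (hg : PolyGrowth g) (x : X) {k : ℕ} (hk : k < L₀) (hgd : DependsOn g ((lowerBlock x k : Finset (PIdx X L₀ N)) : Set (PIdx X L₀ N)))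
    (a b c d : Fin N) :
    ∫ η, g η * (matOf η x ⟨k, hk⟩ a b * conj (matOf η x ⟨k, hk⟩ c d)) ∂gaussianPi (PIdx X L₀ N) J =
      (∫ η, g η ∂gaussianPi (PIdx X L₀ N) J) * ((if a = c ∧ b = d then 2 * (J : ℝ) else 0 : ℝ) : ℂ) := by
  rw [gaussianPi_eq_piMeasure, LatticeRP.integral_mul_eq_of_dependsOn (gaussianReal 0 J)
    (lowerBlock x k) (layerBlock x ⟨k, hk⟩) (disjoint_lowerBlock_layerBlock x hk)
    (f := g) (g := fun η => matOf η x ⟨k, hk⟩ a b * conj (matOf η x ⟨k, hk⟩ c d)) hg.measurable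
    ((continuous_matOf_apply x _ a b).mul
      (Complex.continuous_conj.comp (continuous_matOf_apply x _ c d))).measurable hgd
    (fun η η' h => by
      have e1 : matOf η x ⟨k, hk⟩ a b = matOf η' x ⟨k, hk⟩ a b := dependsOn_matOf_apply_layer x _ a b h
      have e2 : matOf η x ⟨k, hk⟩ c d = matOf η' x ⟨k, hk⟩ c d := dependsOn_matOf_apply_layer x _ c d h
      show matOf η x ⟨k, hk⟩ a b * conj (matOf η x ⟨k, hk⟩ c d) =
        matOf η' x ⟨k, hk⟩ a b * conj (matOf η' x ⟨k, hk⟩ c d)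
      rw [e1, e2]),
    ← gaussianPi_eq_piMeasure, integral_matOf_apply_mul_conj]

/-! ### The mean-value property -/

variable (J)

/-- **Mean-value property of the layer products**: `∫ Q_k(w + η/J) dγ(η) = Q_k(w)` entrywise.
[folklore] -/
theorem integral_layerProd_shift_apply (w : PIdx X L₀ N → ℝ) (x : X) (k : ℕ) (a b : Fin N) :
    ∫ η, layerProd (w + (J : ℝ)⁻¹ • η) x k a b ∂gaussianPi (PIdx X L₀ N) J = layerProd w x k a b := by
  induction k generalizing a b with
  | zero => simp
  | succ k ih =>
      by_cases hk : k < L₀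
      · simp only [layerProd, hk, dite_true, Matrix.mul_apply]
        rw [integral_finsetSum _ fun c _ => ((polyGrowth_layerProd_shift_apply w x k a c).mul
          (polyGrowth_matOf_shift_apply w x ⟨k, hk⟩ c b)).integrable J]
        refine Finset.sum_congr rfl fun c _ => ?_
        have hsplit : ∀ η : PIdx X L₀ N → ℝ,
            layerProd (w + (J : ℝ)⁻¹ • η) x k a c * matOf (w + (J : ℝ)⁻¹ • η) x ⟨k, hk⟩ c b =
            layerProd (w + (J : ℝ)⁻¹ • η) x k a c * matOf w x ⟨k, hk⟩ c b +
              ((J : ℝ)⁻¹ : ℂ) * (layerProd (w + (J : ℝ)⁻¹ • η) x k a c * matOf η x ⟨k, hk⟩ c b) := by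
          intro η
          rw [matOf_shift]
          simp only [Matrix.add_apply, Matrix.smul_apply, smul_eq_mul]
          ring
        simp_rw [hsplit]
        rw [integral_add (((polyGrowth_layerProd_shift_apply w x k a c).mul
            (PolyGrowth.const _)).integrable J) ((PolyGrowth.const _).mul
            ((polyGrowth_layerProd_shift_apply w x k a c).mul (polyGrowth_matOf_apply x _ c b))
            |>.integrable J),
          integral_mul_const, integral_const_mul, ih a c,
          integral_mul_matOf_apply_of_dependsOn (polyGrowth_layerProd_shift_apply w x k a c) x hk
            (dependsOn_layerProd_shift_apply w x k a c)]
        simp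
      · simp only [layerProd, hk, dite_false, Matrix.mul_one]
        exact ih a b

/-- **Mean-value property of the Polyakov trace**: `∫ P_x(w + η/J) dγ(η) = P_x(w)`. [folklore] -/
theorem integral_polyTrace_shift (w : PIdx X L₀ N → ℝ) (x : X) :
    ∫ η, polyTrace (w + (J : ℝ)⁻¹ • η) x ∂gaussianPi (PIdx X L₀ N) J = polyTrace w x := by
  unfold polyTrace Matrix.trace
  rw [integral_finsetSum _ fun a _ => ?_]
  · exact Finset.sum_congr rfl fun a _ => integral_layerProd_shift_apply J w x L₀ a a
  · simpa [Matrix.diag] using (polyGrowth_layerProd_shift_apply (J := J) w x L₀ a a).integrable J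

/-- **Mean-value property of the smeared trace**: `∫ F_h(w + η/J) dγ(η) = F_h(w)`. [folklore] -/
theorem integral_smearedPoly_shift (h : X → ℂ) (w : PIdx X L₀ N → ℝ) :
    ∫ η, smearedPoly h (w + (J : ℝ)⁻¹ • η) ∂gaussianPi (PIdx X L₀ N) J = smearedPoly h w := by
  unfold smearedPoly
  rw [integral_finsetSum _ fun x _ =>
    ((PolyGrowth.const _).mul (polyGrowth_polyTrace_shift w x)).integrable J]
  exact Finset.sum_congr rfl fun x _ => by rw [integral_const_mul, integral_polyTrace_shift]

/-! ### Integrating out one layer -/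

variable {J}

/-- Conjugate form of the first-moment independence: `∫ g · conj H_ab = 0`. [folklore] -/
theorem integral_mul_conj_matOf_apply_of_dependsOn {g : (PIdx X L₀ N → ℝ) → ℂ} (hg : PolyGrowth g)
    (x : X) {k : ℕ} (hk : k < L₀)
    (hgd : DependsOn g ((lowerBlock x k : Finset (PIdx X L₀ N)) : Set (PIdx X L₀ N))) (a b : Fin N) :
    ∫ η, g η * conj (matOf η x ⟨k, hk⟩ a b) ∂gaussianPi (PIdx X L₀ N) J = 0 := by
  have h := integral_mul_matOf_apply_of_dependsOn (J := J) hg.cconj x hk (fun η η' hηη' => by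
    show conj (g η) = conj (g η')
    rw [hgd hηη']) a b
  have h2 := congrArg conj h
  rw [← integral_conj, map_zero] at h2
  simpa using h2

/-- **Integrating out the layer `k`, first order**: for `g` of polynomial growth depending only
on the layers `< k`, `∫ g · M_da dγ = (∫ g dγ) · W_da`, `M = matOf (w + η/J) x k`,
`W = matOf w x k`. [folklore] -/
theorem integral_mul_matOf_shift_apply {g : (PIdx X L₀ N → ℝ) → ℂ} (hg : PolyGrowth g)
    (w : PIdx X L₀ N → ℝ) (x : X) {k : ℕ} (hk : k < L₀)
    (hgd : DependsOn g ((lowerBlock x k : Finset (PIdx X L₀ N)) : Set (PIdx X L₀ N))) (d a : Fin N) :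
    ∫ η, g η * matOf (w + (J : ℝ)⁻¹ • η) x ⟨k, hk⟩ d a ∂gaussianPi (PIdx X L₀ N) J =
      (∫ η, g η ∂gaussianPi (PIdx X L₀ N) J) * matOf w x ⟨k, hk⟩ d a := by
  have hsplit : ∀ η : PIdx X L₀ N → ℝ, g η * matOf (w + (J : ℝ)⁻¹ • η) x ⟨k, hk⟩ d a =
      g η * matOf w x ⟨k, hk⟩ d a + ((J : ℝ)⁻¹ : ℂ) * (g η * matOf η x ⟨k, hk⟩ d a) := fun η => by
    rw [matOf_shift]; simp only [Matrix.add_apply, Matrix.smul_apply, smul_eq_mul]; ring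
  simp_rw [hsplit]
  rw [integral_add ((hg.mul (PolyGrowth.const _)).integrable J)
      (((PolyGrowth.const _).mul (hg.mul (polyGrowth_matOf_apply x _ d a))).integrable J),
    integral_mul_const, integral_const_mul, integral_mul_matOf_apply_of_dependsOn hg x hk hgd]
  simp

/-- **Integrating out the layer `k`, second order**: for `g` of polynomial growth depending
only on the layers `< k`,
`∫ g · M_da conj M_ea' dγ = (∫ g dγ) · (W_da conj W_ea' + (2/J) [d = e][a = a'])`. [folklore] -/
theorem integral_mul_matOf_shift_apply_mul_conj {g : (PIdx X L₀ N → ℝ) → ℂ} (hg : PolyGrowth g)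
    (w : PIdx X L₀ N → ℝ) (x : X) {k : ℕ} (hk : k < L₀)
    (hgd : DependsOn g ((lowerBlock x k : Finset (PIdx X L₀ N)) : Set (PIdx X L₀ N)))
    (d a e a' : Fin N) :
    ∫ η, g η * (matOf (w + (J : ℝ)⁻¹ • η) x ⟨k, hk⟩ d a *
        conj (matOf (w + (J : ℝ)⁻¹ • η) x ⟨k, hk⟩ e a')) ∂gaussianPi (PIdx X L₀ N) J =
      (∫ η, g η ∂gaussianPi (PIdx X L₀ N) J) *
        (matOf w x ⟨k, hk⟩ d a * conj (matOf w x ⟨k, hk⟩ e a') +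
          ((if d = e ∧ a = a' then 2 / (J : ℝ) else 0 : ℝ) : ℂ)) := by
  rcases eq_or_ne J 0 with hJ | hJ
  · -- degenerate variance: `J⁻¹ = 0`, no randomness enters
    subst hJ
    have h0 : ∀ η : PIdx X L₀ N → ℝ, w + ((0 : ℝ≥0) : ℝ)⁻¹ • η = w := fun η => by simp
    simp_rw [h0]
    rw [integral_mul_const]
    simp
  have hJ' : (J : ℝ) ≠ 0 := by exact_mod_cast hJ
  set W := matOf w x ⟨k, hk⟩ with hW
  have hsplit : ∀ η : PIdx X L₀ N → ℝ,
      g η * (matOf (w + (J : ℝ)⁻¹ • η) x ⟨k, hk⟩ d a * conj (matOf (w + (J : ℝ)⁻¹ • η) x ⟨k, hk⟩ e a')) =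
      g η * (W d a * conj (W e a'))
        + ((J : ℝ)⁻¹ : ℂ) * conj (W e a') * (g η * matOf η x ⟨k, hk⟩ d a)
        + ((J : ℝ)⁻¹ : ℂ) * W d a * (g η * conj (matOf η x ⟨k, hk⟩ e a'))
        + ((J : ℝ)⁻¹ : ℂ) ^ 2 * (g η * (matOf η x ⟨k, hk⟩ d a * conj (matOf η x ⟨k, hk⟩ e a'))) := by
    intro η
    rw [matOf_shift]
    simp only [Matrix.add_apply, Matrix.smul_apply, smul_eq_mul, map_add, map_mul, hW]
    have : conj (((J : ℝ)⁻¹ : ℂ)) = ((J : ℝ)⁻¹ : ℂ) := by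
      rw [← Complex.ofReal_inv, Complex.conj_ofReal]
    rw [this]
    ring
  simp_rw [hsplit]
  have hH := polyGrowth_matOf_apply (X := X) (L₀ := L₀) (N := N) x ⟨k, hk⟩
  have i1 : Integrable (fun η => g η * (W d a * conj (W e a'))) (gaussianPi (PIdx X L₀ N) J) :=
    (hg.mul (PolyGrowth.const _)).integrable J
  have i2 : Integrable (fun η => ((J : ℝ)⁻¹ : ℂ) * conj (W e a') * (g η * matOf η x ⟨k, hk⟩ d a))
      (gaussianPi (PIdx X L₀ N) J) := ((PolyGrowth.const _).mul (hg.mul (hH d a))).integrable J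
  have i3 : Integrable (fun η => ((J : ℝ)⁻¹ : ℂ) * W d a * (g η * conj (matOf η x ⟨k, hk⟩ e a')))
      (gaussianPi (PIdx X L₀ N) J) := ((PolyGrowth.const _).mul (hg.mul (hH e a').cconj)).integrable J
  have i4 : Integrable (fun η => ((J : ℝ)⁻¹ : ℂ) ^ 2 *
      (g η * (matOf η x ⟨k, hk⟩ d a * conj (matOf η x ⟨k, hk⟩ e a')))) (gaussianPi (PIdx X L₀ N) J) :=
    ((PolyGrowth.const _).mul (hg.mul ((hH d a).mul (hH e a').cconj))).integrable J
  have i12 : Integrable (fun η => g η * (W d a * conj (W e a'))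
      + ((J : ℝ)⁻¹ : ℂ) * conj (W e a') * (g η * matOf η x ⟨k, hk⟩ d a)) (gaussianPi (PIdx X L₀ N) J) :=
    i1.add i2
  have i123 : Integrable (fun η => g η * (W d a * conj (W e a'))
      + ((J : ℝ)⁻¹ : ℂ) * conj (W e a') * (g η * matOf η x ⟨k, hk⟩ d a)
      + ((J : ℝ)⁻¹ : ℂ) * W d a * (g η * conj (matOf η x ⟨k, hk⟩ e a'))) (gaussianPi (PIdx X L₀ N) J) :=
    i12.add i3
  rw [integral_add i123 i4, integral_add i12 i3, integral_add i1 i2,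
    integral_mul_const, integral_const_mul, integral_const_mul, integral_const_mul,
    integral_mul_matOf_apply_of_dependsOn hg x hk hgd,
    integral_mul_conj_matOf_apply_of_dependsOn hg x hk hgd,
    integral_mul_matOf_apply_mul_conj_of_dependsOn hg x hk hgd]
  simp only [mul_zero, add_zero]
  split_ifs with hde
  · push_cast
    field_simp
  · simp

/-- **Integrating out the layer `k`, matrix form**: for `g` of polynomial growth depending only
on the layers `< k` and a unitary `W = matOf w x k`,
`∫ g · (M Mᴴ)_{ed} dγ = (∫ g dγ) (1 + 2N/J) [e = d]`, `M = matOf (w + η/J) x k`. [folklore] -/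
theorem integral_mul_matOf_shift_mul_conjTranspose {g : (PIdx X L₀ N → ℝ) → ℂ} (hg : PolyGrowth g)
    (w : PIdx X L₀ N → ℝ) (x : X) {k : ℕ} (hk : k < L₀)
    (hW : matOf w x ⟨k, hk⟩ ∈ Matrix.unitaryGroup (Fin N) ℂ)
    (hgd : DependsOn g ((lowerBlock x k : Finset (PIdx X L₀ N)) : Set (PIdx X L₀ N))) (e d : Fin N) :
    ∫ η, g η * (matOf (w + (J : ℝ)⁻¹ • η) x ⟨k, hk⟩ *
        (matOf (w + (J : ℝ)⁻¹ • η) x ⟨k, hk⟩)ᴴ) e d ∂gaussianPi (PIdx X L₀ N) J =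
      (∫ η, g η ∂gaussianPi (PIdx X L₀ N) J) *
        (((1 + 2 * N / (J : ℝ) : ℝ) : ℂ) * (if e = d then 1 else 0)) := by
  have hexp : ∀ η : PIdx X L₀ N → ℝ,
      g η * (matOf (w + (J : ℝ)⁻¹ • η) x ⟨k, hk⟩ * (matOf (w + (J : ℝ)⁻¹ • η) x ⟨k, hk⟩)ᴴ) e d =
      ∑ a, g η * (matOf (w + (J : ℝ)⁻¹ • η) x ⟨k, hk⟩ e a *
        conj (matOf (w + (J : ℝ)⁻¹ • η) x ⟨k, hk⟩ d a)) := fun η => by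
    simp only [Matrix.mul_apply, Matrix.conjTranspose_apply, Complex.star_def, Finset.mul_sum]
  simp_rw [hexp]
  rw [integral_finsetSum _ fun a _ => (hg.mul ((polyGrowth_matOf_shift_apply w x _ e a).mul
    (polyGrowth_matOf_shift_apply w x _ d a).cconj)).integrable J]
  simp_rw [integral_mul_matOf_shift_apply_mul_conj hg w x hk hgd]
  rw [← Finset.mul_sum, Finset.sum_add_distrib]
  congr 1
  have hU : ∑ a, matOf w x ⟨k, hk⟩ e a * conj (matOf w x ⟨k, hk⟩ d a) =
      (if e = d then 1 else 0 : ℂ) := by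
    have h1 := Matrix.mem_unitaryGroup_iff.1 hW
    have h2 : (matOf w x ⟨k, hk⟩ * star (matOf w x ⟨k, hk⟩)) e d =
        (1 : Matrix (Fin N) (Fin N) ℂ) e d := by rw [h1]
    rw [Matrix.mul_apply, Matrix.one_apply] at h2
    simpa [Matrix.star_apply, Complex.star_def] using h2
  rw [hU]
  by_cases hed : e = d
  · subst hed
    simp only [and_self, if_true, mul_one]
    rw [Finset.sum_const, Finset.card_univ, Fintype.card_fin, nsmul_eq_mul]
    push_cast
    ring
  · simp [hed]

/-! ### Second moments: the sandwich `tr(Q_kᴴ X Q_k)` -/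

variable (J)

/-- Entrywise dependence of the conjugate-transposed lower product. [folklore] -/
theorem dependsOn_sandwich_apply (w : PIdx X L₀ N → ℝ) (x : X) (k : ℕ)
    (Xm : Matrix (Fin N) (Fin N) ℂ) (d e : Fin N) :
    DependsOn (fun η : PIdx X L₀ N → ℝ =>
      ((layerProd (w + (J : ℝ)⁻¹ • η) x k)ᴴ * Xm * layerProd (w + (J : ℝ)⁻¹ • η) x k) d e)
      ((lowerBlock x k : Finset (PIdx X L₀ N)) : Set (PIdx X L₀ N)) := by
  intro η η' h
  have hQ : layerProd (w + (J : ℝ)⁻¹ • η) x k = layerProd (w + (J : ℝ)⁻¹ • η') x k := by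
    ext a b
    exact dependsOn_layerProd_shift_apply (J := J) w x k a b h
  simp only [hQ]

omit [DecidableEq X] in
/-- Entries of the sandwich have polynomial growth. [folklore] -/
theorem polyGrowth_sandwich_apply (w : PIdx X L₀ N → ℝ) (x : X) (k : ℕ)
    (Xm : Matrix (Fin N) (Fin N) ℂ) (d e : Fin N) :
    PolyGrowth (fun η : PIdx X L₀ N → ℝ =>
      ((layerProd (w + (J : ℝ)⁻¹ • η) x k)ᴴ * Xm * layerProd (w + (J : ℝ)⁻¹ • η) x k) d e) := by
  simp only [Matrix.mul_apply, Matrix.conjTranspose_apply, Complex.star_def]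
  exact PolyGrowth.sum _ fun b _ => (PolyGrowth.sum _ fun c _ =>
    (polyGrowth_layerProd_shift_apply w x k c d).cconj.mul (PolyGrowth.const _)).mul
      (polyGrowth_layerProd_shift_apply w x k b e)

/-- **The sandwich recursion.** If the layers of `w` at `x` are unitary, then for `k ≤ L₀` and
every matrix `Xm`, `∫ tr(Q_k(w + η/J)ᴴ Xm Q_k(w + η/J)) dγ(η) = (1 + 2N/J)^k tr Xm`. [folklore] -/
theorem integral_trace_sandwich (w : PIdx X L₀ N → ℝ) (x : X)
    (hw : ∀ m : Fin L₀, matOf w x m ∈ Matrix.unitaryGroup (Fin N) ℂ) (k : ℕ) (hkL : k ≤ L₀)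
    (Xm : Matrix (Fin N) (Fin N) ℂ) :
    ∫ η, ((layerProd (w + (J : ℝ)⁻¹ • η) x k)ᴴ * Xm * layerProd (w + (J : ℝ)⁻¹ • η) x k).trace
        ∂gaussianPi (PIdx X L₀ N) J = (((1 + 2 * N / (J : ℝ)) ^ k : ℝ) : ℂ) * Xm.trace := by
  induction k generalizing Xm with
  | zero => simp
  | succ k ih =>
      have hk : k < L₀ := hkL
      -- `tr(Q_{k+1}ᴴ X Q_{k+1}) = tr(M Mᴴ Y) = Σ_e Σ_d (M Mᴴ)_ed Y_de`, `Y = Q_kᴴ X Q_k`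
      have hexp : ∀ η : PIdx X L₀ N → ℝ,
          ((layerProd (w + (J : ℝ)⁻¹ • η) x (k + 1))ᴴ * Xm *
              layerProd (w + (J : ℝ)⁻¹ • η) x (k + 1)).trace
            = ∑ e, ∑ d, ((layerProd (w + (J : ℝ)⁻¹ • η) x k)ᴴ * Xm *
                layerProd (w + (J : ℝ)⁻¹ • η) x k) d e *
              (matOf (w + (J : ℝ)⁻¹ • η) x ⟨k, hk⟩ * (matOf (w + (J : ℝ)⁻¹ • η) x ⟨k, hk⟩)ᴴ) e d := by
        intro η
        rw [layerProd_succ _ x hk, Matrix.conjTranspose_mul]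
        have hassoc : (matOf (w + (J : ℝ)⁻¹ • η) x ⟨k, hk⟩)ᴴ * (layerProd (w + (J : ℝ)⁻¹ • η) x k)ᴴ * Xm *
            (layerProd (w + (J : ℝ)⁻¹ • η) x k * matOf (w + (J : ℝ)⁻¹ • η) x ⟨k, hk⟩) =
            (matOf (w + (J : ℝ)⁻¹ • η) x ⟨k, hk⟩)ᴴ *
              ((layerProd (w + (J : ℝ)⁻¹ • η) x k)ᴴ * Xm * layerProd (w + (J : ℝ)⁻¹ • η) x k) *
              matOf (w + (J : ℝ)⁻¹ • η) x ⟨k, hk⟩ := by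
          simp only [Matrix.mul_assoc]
        rw [hassoc, Matrix.trace_mul_cycle]
        simp only [Matrix.trace, Matrix.diag]
        refine Finset.sum_congr rfl fun e _ => ?_
        rw [Matrix.mul_apply]
        exact Finset.sum_congr rfl fun d _ => mul_comm _ _
      simp_rw [hexp]
      have hMM : ∀ e d : Fin N, PolyGrowth (fun η : PIdx X L₀ N → ℝ =>
          (matOf (w + (J : ℝ)⁻¹ • η) x ⟨k, hk⟩ * (matOf (w + (J : ℝ)⁻¹ • η) x ⟨k, hk⟩)ᴴ) e d) := by
        intro e d
        simp only [Matrix.mul_apply, Matrix.conjTranspose_apply, Complex.star_def]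
        exact PolyGrowth.sum _ fun a _ => (polyGrowth_matOf_shift_apply w x _ e a).mul
          (polyGrowth_matOf_shift_apply w x _ d a).cconj
      rw [integral_finsetSum _ fun e _ => (PolyGrowth.sum _ fun d _ =>
        (polyGrowth_sandwich_apply J w x k Xm d e).mul (hMM e d)).integrable J]
      have hinner : ∀ e : Fin N,
          ∫ η, ∑ d, ((layerProd (w + (J : ℝ)⁻¹ • η) x k)ᴴ * Xm * layerProd (w + (J : ℝ)⁻¹ • η) x k) d e *
              (matOf (w + (J : ℝ)⁻¹ • η) x ⟨k, hk⟩ * (matOf (w + (J : ℝ)⁻¹ • η) x ⟨k, hk⟩)ᴴ) e d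
            ∂gaussianPi (PIdx X L₀ N) J =
          ((1 + 2 * N / (J : ℝ) : ℝ) : ℂ) *
            ∫ η, ((layerProd (w + (J : ℝ)⁻¹ • η) x k)ᴴ * Xm * layerProd (w + (J : ℝ)⁻¹ • η) x k) e e
              ∂gaussianPi (PIdx X L₀ N) J := by
        intro e
        rw [integral_finsetSum _ fun d _ =>
          ((polyGrowth_sandwich_apply J w x k Xm d e).mul (hMM e d)).integrable J]
        have hterm : ∀ d : Fin N,
            ∫ η, ((layerProd (w + (J : ℝ)⁻¹ • η) x k)ᴴ * Xm * layerProd (w + (J : ℝ)⁻¹ • η) x k) d e *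
                (matOf (w + (J : ℝ)⁻¹ • η) x ⟨k, hk⟩ * (matOf (w + (J : ℝ)⁻¹ • η) x ⟨k, hk⟩)ᴴ) e d
              ∂gaussianPi (PIdx X L₀ N) J =
            (∫ η, ((layerProd (w + (J : ℝ)⁻¹ • η) x k)ᴴ * Xm * layerProd (w + (J : ℝ)⁻¹ • η) x k) d e
              ∂gaussianPi (PIdx X L₀ N) J) *
              (((1 + 2 * N / (J : ℝ) : ℝ) : ℂ) * (if e = d then 1 else 0)) := fun d =>
          integral_mul_matOf_shift_mul_conjTranspose (polyGrowth_sandwich_apply J w x k Xm d e) w x hk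
            (hw ⟨k, hk⟩) (dependsOn_sandwich_apply J w x k Xm d e) e d
        simp_rw [hterm]
        rw [Finset.sum_eq_single e (fun d _ hde => by simp [Ne.symm hde]) (by simp)]
        simp [mul_comm]
      simp_rw [hinner]
      rw [← Finset.mul_sum, ← integral_finsetSum _ fun e _ =>
        (polyGrowth_sandwich_apply J w x k Xm e e).integrable J]
      have htr : ∀ η : PIdx X L₀ N → ℝ,
          ∑ e, ((layerProd (w + (J : ℝ)⁻¹ • η) x k)ᴴ * Xm * layerProd (w + (J : ℝ)⁻¹ • η) x k) e e =
          ((layerProd (w + (J : ℝ)⁻¹ • η) x k)ᴴ * Xm * layerProd (w + (J : ℝ)⁻¹ • η) x k).trace :=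
        fun η => rfl
      simp_rw [htr]
      rw [ih (Nat.le_of_succ_le hkL) Xm, ← mul_assoc]
      congr 1
      push_cast
      ring

/-! ### Second moments: `|tr(A Q_k)|²` and the variance of the Polyakov trace -/

omit [Fintype X] [DecidableEq X] in
/-- `tr(U W) = Σ_{(e,a)} U_ea W_ae` as a sum over pairs. [folklore] -/
theorem trace_mul_eq_sum_pairs (U W : Matrix (Fin N) (Fin N) ℂ) :
    (U * W).trace = ∑ p : Fin N × Fin N, U p.1 p.2 * W p.2 p.1 := by
  rw [Matrix.trace]
  simp only [Matrix.diag, Matrix.mul_apply]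
  rw [← Finset.univ_product_univ, Finset.sum_product]

omit [Fintype X] [DecidableEq X] in
/-- `Σ_{(e,a)} U_ea conj U_ea = tr(Uᴴ U)`. [folklore] -/
theorem sum_pairs_mul_conj_eq_trace (U : Matrix (Fin N) (Fin N) ℂ) :
    ∑ p : Fin N × Fin N, U p.1 p.2 * conj (U p.1 p.2) = (Uᴴ * U).trace := by
  rw [Matrix.trace]
  simp only [Matrix.diag, Matrix.mul_apply, Matrix.conjTranspose_apply, Complex.star_def]
  rw [← Finset.univ_product_univ, Finset.sum_product, Finset.sum_comm]
  exact Finset.sum_congr rfl fun a _ => Finset.sum_congr rfl fun e _ => mul_comm _ _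

omit [DecidableEq X] in
/-- Entries of `A Q_k(w + η/J)` have polynomial growth. [folklore] -/
theorem polyGrowth_mul_layerProd_shift_apply (A : Matrix (Fin N) (Fin N) ℂ) (w : PIdx X L₀ N → ℝ)
    (x : X) (k : ℕ) (e a : Fin N) :
    PolyGrowth (fun η : PIdx X L₀ N → ℝ => (A * layerProd (w + (J : ℝ)⁻¹ • η) x k) e a) := by
  simp only [Matrix.mul_apply]
  exact PolyGrowth.sum _ fun b _ => (PolyGrowth.const _).mul (polyGrowth_layerProd_shift_apply w x k b a)

/-- Entries of `A Q_k(w + η/J)` depend only on the lower block. [folklore] -/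
theorem dependsOn_mul_layerProd_shift_apply (A : Matrix (Fin N) (Fin N) ℂ) (w : PIdx X L₀ N → ℝ)
    (x : X) (k : ℕ) (e a : Fin N) :
    DependsOn (fun η : PIdx X L₀ N → ℝ => (A * layerProd (w + (J : ℝ)⁻¹ • η) x k) e a)
      ((lowerBlock x k : Finset (PIdx X L₀ N)) : Set (PIdx X L₀ N)) := by
  intro η η' h
  have hQ : layerProd (w + (J : ℝ)⁻¹ • η) x k = layerProd (w + (J : ℝ)⁻¹ • η') x k := by
    ext b c
    exact dependsOn_layerProd_shift_apply (J := J) w x k b c h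
  simp only [hQ]

/-- **The second-moment recursion for `|tr(A Q_k)|²`.** If the layers of `w` at `x` are
unitary, then for `k ≤ L₀` and every matrix `A`,
`∫ |tr(A Q_k(w + η/J))|² dγ(η) = |tr(A Q_k(w))|² + (2/J) tr(Aᴴ A) Σ_{j<k} (1 + 2N/J)^j`.
[folklore] -/
theorem integral_normSq_trace_mul_layerProd (w : PIdx X L₀ N → ℝ) (x : X)
    (hw : ∀ m : Fin L₀, matOf w x m ∈ Matrix.unitaryGroup (Fin N) ℂ) (k : ℕ) (hkL : k ≤ L₀)
    (A : Matrix (Fin N) (Fin N) ℂ) :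
    ∫ η, (A * layerProd (w + (J : ℝ)⁻¹ • η) x k).trace *
        conj ((A * layerProd (w + (J : ℝ)⁻¹ • η) x k).trace) ∂gaussianPi (PIdx X L₀ N) J =
      (A * layerProd w x k).trace * conj ((A * layerProd w x k).trace) +
        (((2 / (J : ℝ)) * ∑ j ∈ Finset.range k, (1 + 2 * N / (J : ℝ)) ^ j : ℝ) : ℂ) *
          (Aᴴ * A).trace := by
  induction k generalizing A with
  | zero => simp
  | succ k ih =>
      have hk : k < L₀ := hkL
      have hkle : k ≤ L₀ := Nat.le_of_succ_le hkL
      -- abbreviations (as functions of `η`)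
      have hU := polyGrowth_mul_layerProd_shift_apply (J := J) A w x k
      have hUd := dependsOn_mul_layerProd_shift_apply (J := J) A w x k
      have hM := polyGrowth_matOf_shift_apply (J := J) w x ⟨k, hk⟩
      -- Step 1: expand `|tr(A Q_{k+1})|²` into a double sum over pairs
      have hexp : ∀ η : PIdx X L₀ N → ℝ,
          (A * layerProd (w + (J : ℝ)⁻¹ • η) x (k + 1)).trace *
            conj ((A * layerProd (w + (J : ℝ)⁻¹ • η) x (k + 1)).trace) =
          ∑ p : Fin N × Fin N, ∑ q : Fin N × Fin N,
            ((A * layerProd (w + (J : ℝ)⁻¹ • η) x k) p.1 p.2 *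
              conj ((A * layerProd (w + (J : ℝ)⁻¹ • η) x k) q.1 q.2)) *
            (matOf (w + (J : ℝ)⁻¹ • η) x ⟨k, hk⟩ p.2 p.1 *
              conj (matOf (w + (J : ℝ)⁻¹ • η) x ⟨k, hk⟩ q.2 q.1)) := by
        intro η
        rw [layerProd_succ _ x hk, ← Matrix.mul_assoc, trace_mul_eq_sum_pairs, map_sum,
          Finset.sum_mul_sum]
        refine Finset.sum_congr rfl fun p _ => Finset.sum_congr rfl fun q _ => ?_
        rw [map_mul]; ring
      simp_rw [hexp]
      -- Step 2: integrate termwise, integrating out the layer `k`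
      have hint_pq : ∀ p q : Fin N × Fin N, Integrable (fun η : PIdx X L₀ N → ℝ =>
          ((A * layerProd (w + (J : ℝ)⁻¹ • η) x k) p.1 p.2 *
            conj ((A * layerProd (w + (J : ℝ)⁻¹ • η) x k) q.1 q.2)) *
          (matOf (w + (J : ℝ)⁻¹ • η) x ⟨k, hk⟩ p.2 p.1 *
            conj (matOf (w + (J : ℝ)⁻¹ • η) x ⟨k, hk⟩ q.2 q.1))) (gaussianPi (PIdx X L₀ N) J) :=
        fun p q => (((hU p.1 p.2).mul (hU q.1 q.2).cconj).mul
          ((hM p.2 p.1).mul (hM q.2 q.1).cconj)).integrable J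
      rw [integral_finsetSum _ fun p _ => integrable_finsetSum _ fun q _ => hint_pq p q]
      simp_rw [integral_finsetSum _ fun q _ => hint_pq _ q]
      have hterm : ∀ p q : Fin N × Fin N,
          ∫ η, ((A * layerProd (w + (J : ℝ)⁻¹ • η) x k) p.1 p.2 *
              conj ((A * layerProd (w + (J : ℝ)⁻¹ • η) x k) q.1 q.2)) *
            (matOf (w + (J : ℝ)⁻¹ • η) x ⟨k, hk⟩ p.2 p.1 *
              conj (matOf (w + (J : ℝ)⁻¹ • η) x ⟨k, hk⟩ q.2 q.1)) ∂gaussianPi (PIdx X L₀ N) J =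
          (∫ η, (A * layerProd (w + (J : ℝ)⁻¹ • η) x k) p.1 p.2 *
              conj ((A * layerProd (w + (J : ℝ)⁻¹ • η) x k) q.1 q.2) ∂gaussianPi (PIdx X L₀ N) J) *
            (matOf w x ⟨k, hk⟩ p.2 p.1 * conj (matOf w x ⟨k, hk⟩ q.2 q.1) +
              ((if p = q then 2 / (J : ℝ) else 0 : ℝ) : ℂ)) := by
        intro p q
        rw [integral_mul_matOf_shift_apply_mul_conj ((hU p.1 p.2).mul (hU q.1 q.2).cconj) w x hk
          (fun η η' h => by
            have e1 : (A * layerProd (w + (J : ℝ)⁻¹ • η) x k) p.1 p.2 =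
                (A * layerProd (w + (J : ℝ)⁻¹ • η') x k) p.1 p.2 := hUd p.1 p.2 h
            have e2 : (A * layerProd (w + (J : ℝ)⁻¹ • η) x k) q.1 q.2 =
                (A * layerProd (w + (J : ℝ)⁻¹ • η') x k) q.1 q.2 := hUd q.1 q.2 h
            show (A * layerProd (w + (J : ℝ)⁻¹ • η) x k) p.1 p.2 *
                conj ((A * layerProd (w + (J : ℝ)⁻¹ • η) x k) q.1 q.2) =
              (A * layerProd (w + (J : ℝ)⁻¹ • η') x k) p.1 p.2 *
                conj ((A * layerProd (w + (J : ℝ)⁻¹ • η') x k) q.1 q.2)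
            rw [e1, e2]) p.2 p.1 q.2 q.1]
        congr 3
        by_cases hpq : p = q
        · subst hpq; simp
        · have hn : ¬(p.2 = q.2 ∧ p.1 = q.1) := fun h' => hpq (Prod.ext h'.2 h'.1)
          simp [hpq, hn]
      simp_rw [hterm, mul_add, Finset.sum_add_distrib]
      -- Step 3: the `W` part recombines into `∫ |tr((W A) Q_k)|²`
      have hWpart : ∑ p : Fin N × Fin N, ∑ q : Fin N × Fin N,
          (∫ η, (A * layerProd (w + (J : ℝ)⁻¹ • η) x k) p.1 p.2 *
              conj ((A * layerProd (w + (J : ℝ)⁻¹ • η) x k) q.1 q.2) ∂gaussianPi (PIdx X L₀ N) J) *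
            (matOf w x ⟨k, hk⟩ p.2 p.1 * conj (matOf w x ⟨k, hk⟩ q.2 q.1)) =
          ∫ η, (matOf w x ⟨k, hk⟩ * A * layerProd (w + (J : ℝ)⁻¹ • η) x k).trace *
            conj ((matOf w x ⟨k, hk⟩ * A * layerProd (w + (J : ℝ)⁻¹ • η) x k).trace)
            ∂gaussianPi (PIdx X L₀ N) J := by
        have hint2 : ∀ p q : Fin N × Fin N, Integrable (fun η : PIdx X L₀ N → ℝ =>
            (A * layerProd (w + (J : ℝ)⁻¹ • η) x k) p.1 p.2 *
              conj ((A * layerProd (w + (J : ℝ)⁻¹ • η) x k) q.1 q.2) *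
              (matOf w x ⟨k, hk⟩ p.2 p.1 * conj (matOf w x ⟨k, hk⟩ q.2 q.1)))
            (gaussianPi (PIdx X L₀ N) J) :=
          fun p q => (((hU p.1 p.2).mul (hU q.1 q.2).cconj).mul (PolyGrowth.const _)).integrable J
        simp_rw [← integral_mul_const]
        have hin : ∀ p : Fin N × Fin N, ∑ q : Fin N × Fin N, ∫ η,
            (A * layerProd (w + (J : ℝ)⁻¹ • η) x k) p.1 p.2 *
              conj ((A * layerProd (w + (J : ℝ)⁻¹ • η) x k) q.1 q.2) *
              (matOf w x ⟨k, hk⟩ p.2 p.1 * conj (matOf w x ⟨k, hk⟩ q.2 q.1)) ∂gaussianPi (PIdx X L₀ N) J =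
            ∫ η, ∑ q : Fin N × Fin N, (A * layerProd (w + (J : ℝ)⁻¹ • η) x k) p.1 p.2 *
              conj ((A * layerProd (w + (J : ℝ)⁻¹ • η) x k) q.1 q.2) *
              (matOf w x ⟨k, hk⟩ p.2 p.1 * conj (matOf w x ⟨k, hk⟩ q.2 q.1)) ∂gaussianPi (PIdx X L₀ N) J :=
          fun p => (integral_finsetSum _ fun q _ => hint2 p q).symm
        simp_rw [hin]
        rw [← integral_finsetSum _ fun p _ => integrable_finsetSum _ fun q _ => hint2 p q]
        refine integral_congr_ae (Filter.Eventually.of_forall fun η => ?_)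
        dsimp only
        have hcyc : (matOf w x ⟨k, hk⟩ * A * layerProd (w + (J : ℝ)⁻¹ • η) x k).trace =
            (A * layerProd (w + (J : ℝ)⁻¹ • η) x k * matOf w x ⟨k, hk⟩).trace := by
          rw [Matrix.mul_assoc, Matrix.trace_mul_comm, Matrix.mul_assoc]
        rw [hcyc, trace_mul_eq_sum_pairs, map_sum, Finset.sum_mul_sum]
        refine Finset.sum_congr rfl fun p _ => Finset.sum_congr rfl fun q _ => ?_
        rw [map_mul]; ring
      -- Step 4: the `2/J` part is the sandwich with `Aᴴ A`
      have hJpart : ∑ p : Fin N × Fin N, ∑ q : Fin N × Fin N,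
          (∫ η, (A * layerProd (w + (J : ℝ)⁻¹ • η) x k) p.1 p.2 *
              conj ((A * layerProd (w + (J : ℝ)⁻¹ • η) x k) q.1 q.2) ∂gaussianPi (PIdx X L₀ N) J) *
            ((if p = q then 2 / (J : ℝ) else 0 : ℝ) : ℂ) =
          ((2 / (J : ℝ) : ℝ) : ℂ) * ((((1 + 2 * N / (J : ℝ)) ^ k : ℝ) : ℂ) * (Aᴴ * A).trace) := by
        have hdiag : ∀ p : Fin N × Fin N, ∑ q : Fin N × Fin N,
            (∫ η, (A * layerProd (w + (J : ℝ)⁻¹ • η) x k) p.1 p.2 *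
                conj ((A * layerProd (w + (J : ℝ)⁻¹ • η) x k) q.1 q.2) ∂gaussianPi (PIdx X L₀ N) J) *
              ((if p = q then 2 / (J : ℝ) else 0 : ℝ) : ℂ) =
            ((2 / (J : ℝ) : ℝ) : ℂ) *
              ∫ η, (A * layerProd (w + (J : ℝ)⁻¹ • η) x k) p.1 p.2 *
                conj ((A * layerProd (w + (J : ℝ)⁻¹ • η) x k) p.1 p.2) ∂gaussianPi (PIdx X L₀ N) J := by
          intro p
          rw [Finset.sum_eq_single p (fun q _ hqp => by simp [Ne.symm hqp]) (by simp)]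
          simp [mul_comm]
        simp_rw [hdiag]
        rw [← Finset.mul_sum, ← integral_finsetSum _ fun p _ =>
          ((hU p.1 p.2).mul (hU p.1 p.2).cconj).integrable J]
        congr 1
        simp_rw [sum_pairs_mul_conj_eq_trace]
        have hassoc : ∀ η : PIdx X L₀ N → ℝ,
            (A * layerProd (w + (J : ℝ)⁻¹ • η) x k)ᴴ * (A * layerProd (w + (J : ℝ)⁻¹ • η) x k) =
            (layerProd (w + (J : ℝ)⁻¹ • η) x k)ᴴ * (Aᴴ * A) * layerProd (w + (J : ℝ)⁻¹ • η) x k := by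
          intro η; rw [Matrix.conjTranspose_mul]; simp only [Matrix.mul_assoc]
        simp_rw [hassoc]
        exact integral_trace_sandwich J w x hw k hkle (Aᴴ * A)
      rw [hWpart, hJpart, ih hkle (matOf w x ⟨k, hk⟩ * A)]
      -- Step 5: algebra: `(WA)ᴴ(WA) = AᴴA`, `tr(W A Q_k(w)) = tr(A Q_{k+1}(w))`, geometric sum
      have hWu : (matOf w x ⟨k, hk⟩)ᴴ * matOf w x ⟨k, hk⟩ = 1 := by
        simpa [Matrix.star_eq_conjTranspose] using Matrix.mem_unitaryGroup_iff'.1 (hw ⟨k, hk⟩)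
      have hWW : (matOf w x ⟨k, hk⟩ * A)ᴴ * (matOf w x ⟨k, hk⟩ * A) = Aᴴ * A := by
        rw [Matrix.conjTranspose_mul, Matrix.mul_assoc, ← Matrix.mul_assoc (matOf w x ⟨k, hk⟩)ᴴ,
          hWu, Matrix.one_mul]
      have hcyc : (matOf w x ⟨k, hk⟩ * A * layerProd w x k).trace = (A * layerProd w x (k + 1)).trace := by
        rw [layerProd_succ _ x hk]
        conv_lhs => rw [Matrix.mul_assoc, Matrix.trace_mul_comm, Matrix.mul_assoc]
      rw [hWW, hcyc, Finset.sum_range_succ]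
      push_cast
      ring

/-- **The variance of the Polyakov trace under heat-kernel smearing.** If the layers of `w` at
`x` are unitary, then `∫ |P_x(w + η/J)|² dγ(η) − |P_x(w)|² = (1 + 2N/J)^{L₀} − 1` (for `J > 0`).
[folklore] -/
theorem integral_normSq_polyTrace_shift (hJ : J ≠ 0) (w : PIdx X L₀ N → ℝ) (x : X)
    (hw : ∀ m : Fin L₀, matOf w x m ∈ Matrix.unitaryGroup (Fin N) ℂ) :
    ∫ η, polyTrace (w + (J : ℝ)⁻¹ • η) x * conj (polyTrace (w + (J : ℝ)⁻¹ • η) x)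
        ∂gaussianPi (PIdx X L₀ N) J =
      polyTrace w x * conj (polyTrace w x) + (((1 + 2 * N / (J : ℝ)) ^ L₀ - 1 : ℝ) : ℂ) := by
  have hJ' : (J : ℝ) ≠ 0 := by exact_mod_cast hJ
  have h := integral_normSq_trace_mul_layerProd J w x hw L₀ le_rfl 1
  simp only [Matrix.one_mul] at h
  unfold polyTrace
  rw [h, Matrix.conjTranspose_one, Matrix.one_mul, Matrix.trace_one, Fintype.card_fin]
  congr 1
  have hgeom : (2 / (J : ℝ)) * (∑ j ∈ Finset.range L₀, (1 + 2 * N / (J : ℝ)) ^ j) * N =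
      (1 + 2 * N / (J : ℝ)) ^ L₀ - 1 := by
    have hg := geom_sum_mul (1 + 2 * N / (J : ℝ)) L₀
    have : (1 + 2 * ↑N / (J : ℝ) - 1) = (2 / (J : ℝ)) * N := by ring
    rw [this] at hg
    linear_combination hg
  rw [← hgeom]
  push_cast
  ring

/-! ### The covariance kernel of the smeared Polyakov trace -/

/-- The centred single-site fluctuation `P_x(w + η/J) − P_x(w)` has squared `L²`-norm
`(1 + 2N/J)^{L₀} − 1` (unitary layers, `J > 0`). [folklore] -/
theorem integral_normSq_polyTrace_shift_sub (hJ : J ≠ 0) (w : PIdx X L₀ N → ℝ) (x : X)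
    (hw : ∀ m : Fin L₀, matOf w x m ∈ Matrix.unitaryGroup (Fin N) ℂ) :
    ∫ η, ‖polyTrace (w + (J : ℝ)⁻¹ • η) x - polyTrace w x‖ ^ 2 ∂gaussianPi (PIdx X L₀ N) J =
      (1 + 2 * N / (J : ℝ)) ^ L₀ - 1 := by
  have hP := polyGrowth_polyTrace_shift (J := J) w x
  have hmv := integral_polyTrace_shift J w x
  have hvar := integral_normSq_polyTrace_shift J hJ w x hw
  -- complex form of the integrand
  have hcplx : ∀ η : PIdx X L₀ N → ℝ,
      (((‖polyTrace (w + (J : ℝ)⁻¹ • η) x - polyTrace w x‖ ^ 2 : ℝ)) : ℂ) =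
      polyTrace (w + (J : ℝ)⁻¹ • η) x * conj (polyTrace (w + (J : ℝ)⁻¹ • η) x)
        - conj (polyTrace w x) * polyTrace (w + (J : ℝ)⁻¹ • η) x
        - polyTrace w x * conj (polyTrace (w + (J : ℝ)⁻¹ • η) x)
        + polyTrace w x * conj (polyTrace w x) := fun η => by
    rw [← Complex.normSq_eq_norm_sq, Complex.normSq_eq_conj_mul_self, map_sub]
    ring
  have hint := integral_complex_ofReal (μ := gaussianPi (PIdx X L₀ N) J)
    (f := fun η => ‖polyTrace (w + (J : ℝ)⁻¹ • η) x - polyTrace w x‖ ^ 2)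
  simp_rw [hcplx] at hint
  have i1 : Integrable (fun η => polyTrace (w + (J : ℝ)⁻¹ • η) x *
      conj (polyTrace (w + (J : ℝ)⁻¹ • η) x)) (gaussianPi (PIdx X L₀ N) J) := (hP.mul hP.cconj).integrable J
  have i2 : Integrable (fun η => conj (polyTrace w x) * polyTrace (w + (J : ℝ)⁻¹ • η) x)
      (gaussianPi (PIdx X L₀ N) J) := ((PolyGrowth.const _).mul hP).integrable J
  have i3 : Integrable (fun η => polyTrace w x * conj (polyTrace (w + (J : ℝ)⁻¹ • η) x))
      (gaussianPi (PIdx X L₀ N) J) := ((PolyGrowth.const _).mul hP.cconj).integrable J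
  have i12 : Integrable (fun η => polyTrace (w + (J : ℝ)⁻¹ • η) x *
      conj (polyTrace (w + (J : ℝ)⁻¹ • η) x) - conj (polyTrace w x) * polyTrace (w + (J : ℝ)⁻¹ • η) x)
      (gaussianPi (PIdx X L₀ N) J) := i1.sub i2
  have i123 : Integrable (fun η => polyTrace (w + (J : ℝ)⁻¹ • η) x *
      conj (polyTrace (w + (J : ℝ)⁻¹ • η) x) - conj (polyTrace w x) * polyTrace (w + (J : ℝ)⁻¹ • η) x
      - polyTrace w x * conj (polyTrace (w + (J : ℝ)⁻¹ • η) x)) (gaussianPi (PIdx X L₀ N) J) := i12.sub i3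
  rw [integral_add i123 (integrable_const _), integral_sub i12 i3, integral_sub i1 i2,
    integral_const_mul, integral_const_mul, integral_conj, hmv, hvar, integral_const, probReal_univ,
    one_smul] at hint
  have hre := congrArg Complex.re hint
  simp only [Complex.ofReal_re, Complex.add_re, Complex.sub_re, Complex.mul_re, Complex.conj_re,
    Complex.conj_im] at hre
  rw [← hre]
  ring

omit [DecidableEq X] in
/-- The squared fluctuation `‖P_x(w + η/J) − P_x(w)‖²` is integrable. [folklore] -/
theorem integrable_normSq_polyTrace_shift_sub (w : PIdx X L₀ N → ℝ) (x : X) :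
    Integrable (fun η => ‖polyTrace (w + (J : ℝ)⁻¹ • η) x - polyTrace w x‖ ^ 2)
      (gaussianPi (PIdx X L₀ N) J) := by
  obtain ⟨hc, C, n, hb⟩ := (polyGrowth_polyTrace_shift (J := J) w x).add (PolyGrowth.const (-polyTrace w x))
  simp only [← sub_eq_add_neg] at hc hb
  refine integrable_of_norm_le_pow_gaussianPi J (hc.norm.pow 2).aestronglyMeasurable
    (C := C ^ 2) (n := n + n) fun η => ?_
  have h := hb η
  rw [Real.norm_eq_abs, abs_of_nonneg (by positivity), pow_add]
  have h2 := pow_le_pow_left₀ (norm_nonneg _) h 2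
  calc ‖polyTrace (w + (J : ℝ)⁻¹ • η) x - polyTrace w x‖ ^ 2 ≤ (C * (1 + ‖η‖) ^ n) ^ 2 := h2
    _ = C ^ 2 * ((1 + ‖η‖) ^ n * (1 + ‖η‖) ^ n) := by ring

/-- **Cross-site independence**: for distinct sites the shifted traces are uncorrelated,
`∫ conj P_y(w' + η/J) · P_x(w + η/J) dγ = conj P_y(w') · P_x(w)` (`x ≠ y`). [folklore] -/
theorem integral_conj_polyTrace_mul_polyTrace_of_ne (w w' : PIdx X L₀ N → ℝ) {x y : X} (hxy : x ≠ y) :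
    ∫ η, conj (polyTrace (w' + (J : ℝ)⁻¹ • η) y) * polyTrace (w + (J : ℝ)⁻¹ • η) x
        ∂gaussianPi (PIdx X L₀ N) J = conj (polyTrace w' y) * polyTrace w x := by
  rw [gaussianPi_eq_piMeasure, LatticeRP.integral_mul_eq_of_dependsOn (gaussianReal 0 J)
    (siteBlock y) (siteBlock x) (disjoint_siteBlock (Ne.symm hxy))
    (f := fun η => conj (polyTrace (w' + (J : ℝ)⁻¹ • η) y)) (g := fun η => polyTrace (w + (J : ℝ)⁻¹ • η) x)
    (polyGrowth_polyTrace_shift w' y).cconj.measurable (polyGrowth_polyTrace_shift w x).measurable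
    (fun η η' h => by
      have e : polyTrace (w' + (J : ℝ)⁻¹ • η) y = polyTrace (w' + (J : ℝ)⁻¹ • η') y :=
        dependsOn_polyTrace_shift (J := J) w' y h
      show conj (polyTrace (w' + (J : ℝ)⁻¹ • η) y) = conj (polyTrace (w' + (J : ℝ)⁻¹ • η') y)
      rw [e])
    (dependsOn_polyTrace_shift w x), ← gaussianPi_eq_piMeasure, integral_conj,
    integral_polyTrace_shift, integral_polyTrace_shift]

/-- **The single-site covariance is bounded by the variance**:
`|∫ conj P_x(w' + η/J) P_x(w + η/J) dγ − conj P_x(w') P_x(w)| ≤ (1 + 2N/J)^{L₀} − 1`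
(unitary layers at `x` for both `w` and `w'`, `J > 0`). [folklore] -/
theorem norm_cov_polyTrace_le (hJ : J ≠ 0) (w w' : PIdx X L₀ N → ℝ) (x : X)
    (hw : ∀ m : Fin L₀, matOf w x m ∈ Matrix.unitaryGroup (Fin N) ℂ)
    (hw' : ∀ m : Fin L₀, matOf w' x m ∈ Matrix.unitaryGroup (Fin N) ℂ) :
    ‖(∫ η, conj (polyTrace (w' + (J : ℝ)⁻¹ • η) x) * polyTrace (w + (J : ℝ)⁻¹ • η) x
        ∂gaussianPi (PIdx X L₀ N) J) - conj (polyTrace w' x) * polyTrace w x‖ ≤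
      (1 + 2 * N / (J : ℝ)) ^ L₀ - 1 := by
  have hP := polyGrowth_polyTrace_shift (J := J) w x
  have hP' := polyGrowth_polyTrace_shift (J := J) w' x
  -- centre: the covariance is the integral of the product of the centred fluctuations
  have hcentre : (∫ η, conj (polyTrace (w' + (J : ℝ)⁻¹ • η) x) * polyTrace (w + (J : ℝ)⁻¹ • η) x
      ∂gaussianPi (PIdx X L₀ N) J) - conj (polyTrace w' x) * polyTrace w x =
      ∫ η, conj (polyTrace (w' + (J : ℝ)⁻¹ • η) x - polyTrace w' x) *
        (polyTrace (w + (J : ℝ)⁻¹ • η) x - polyTrace w x) ∂gaussianPi (PIdx X L₀ N) J := by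
    have hexp : ∀ η : PIdx X L₀ N → ℝ,
        conj (polyTrace (w' + (J : ℝ)⁻¹ • η) x - polyTrace w' x) *
          (polyTrace (w + (J : ℝ)⁻¹ • η) x - polyTrace w x) =
        conj (polyTrace (w' + (J : ℝ)⁻¹ • η) x) * polyTrace (w + (J : ℝ)⁻¹ • η) x
          - conj (polyTrace (w' + (J : ℝ)⁻¹ • η) x) * polyTrace w x
          - conj (polyTrace w' x) * polyTrace (w + (J : ℝ)⁻¹ • η) x
          + conj (polyTrace w' x) * polyTrace w x := fun η => by rw [map_sub]; ring
    simp_rw [hexp]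
    have i1 : Integrable (fun η => conj (polyTrace (w' + (J : ℝ)⁻¹ • η) x) *
        polyTrace (w + (J : ℝ)⁻¹ • η) x) (gaussianPi (PIdx X L₀ N) J) := (hP'.cconj.mul hP).integrable J
    have i2 : Integrable (fun η => conj (polyTrace (w' + (J : ℝ)⁻¹ • η) x) * polyTrace w x)
        (gaussianPi (PIdx X L₀ N) J) := (hP'.cconj.mul (PolyGrowth.const _)).integrable J
    have i3 : Integrable (fun η => conj (polyTrace w' x) * polyTrace (w + (J : ℝ)⁻¹ • η) x)
        (gaussianPi (PIdx X L₀ N) J) := ((PolyGrowth.const _).mul hP).integrable J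
    have i12 : Integrable (fun η => conj (polyTrace (w' + (J : ℝ)⁻¹ • η) x) *
        polyTrace (w + (J : ℝ)⁻¹ • η) x - conj (polyTrace (w' + (J : ℝ)⁻¹ • η) x) * polyTrace w x)
        (gaussianPi (PIdx X L₀ N) J) := i1.sub i2
    have i123 : Integrable (fun η => conj (polyTrace (w' + (J : ℝ)⁻¹ • η) x) *
        polyTrace (w + (J : ℝ)⁻¹ • η) x - conj (polyTrace (w' + (J : ℝ)⁻¹ • η) x) * polyTrace w x
        - conj (polyTrace w' x) * polyTrace (w + (J : ℝ)⁻¹ • η) x) (gaussianPi (PIdx X L₀ N) J) :=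
      i12.sub i3
    rw [integral_add i123 (integrable_const _), integral_sub i12 i3, integral_sub i1 i2,
      integral_mul_const, integral_const_mul, integral_conj, integral_polyTrace_shift,
      integral_polyTrace_shift, integral_const, probReal_univ, one_smul]
    ring
  rw [hcentre]
  -- AM–GM pointwise, then the two variances
  have hu := integrable_normSq_polyTrace_shift_sub J w' x
  have hv := integrable_normSq_polyTrace_shift_sub J w x
  calc ‖∫ η, conj (polyTrace (w' + (J : ℝ)⁻¹ • η) x - polyTrace w' x) *
          (polyTrace (w + (J : ℝ)⁻¹ • η) x - polyTrace w x) ∂gaussianPi (PIdx X L₀ N) J‖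
      ≤ ∫ η, ‖conj (polyTrace (w' + (J : ℝ)⁻¹ • η) x - polyTrace w' x) *
          (polyTrace (w + (J : ℝ)⁻¹ • η) x - polyTrace w x)‖ ∂gaussianPi (PIdx X L₀ N) J :=
        norm_integral_le_integral_norm _
    _ ≤ ∫ η, (‖polyTrace (w' + (J : ℝ)⁻¹ • η) x - polyTrace w' x‖ ^ 2 +
          ‖polyTrace (w + (J : ℝ)⁻¹ • η) x - polyTrace w x‖ ^ 2) / 2 ∂gaussianPi (PIdx X L₀ N) J := by
        refine integral_mono_of_nonneg (Filter.Eventually.of_forall fun η => norm_nonneg _)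
          ((hu.add hv).div_const 2) (Filter.Eventually.of_forall fun η => ?_)
        dsimp only
        rw [norm_mul, Complex.norm_conj]
        nlinarith [sq_nonneg (‖polyTrace (w' + (J : ℝ)⁻¹ • η) x - polyTrace w' x‖ -
          ‖polyTrace (w + (J : ℝ)⁻¹ • η) x - polyTrace w x‖)]
    _ = ((1 + 2 * N / (J : ℝ)) ^ L₀ - 1 + ((1 + 2 * N / (J : ℝ)) ^ L₀ - 1)) / 2 := by
        rw [integral_div, integral_add hu hv, integral_normSq_polyTrace_shift_sub J hJ w' x hw',
          integral_normSq_polyTrace_shift_sub J hJ w x hw]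
    _ = (1 + 2 * N / (J : ℝ)) ^ L₀ - 1 := by ring

/-- **The covariance kernel of the smeared Polyakov trace is bounded by `f Σ|h|²`.** If all layers
of `w` and `w'` (at every site) are unitary and `J > 0`, then
`‖covKernel J (smearedPoly h) w w'‖ ≤ ((1 + 2N/J)^{L₀} − 1) Σ_x ‖h x‖²`: the sum over "broken
Polyakov loops" of Borgs–Seiler's (III.49)–(III.58), each broken loop bounded by `χ(1) = N`.
[cite: BorgsSeiler1983, §III.2 (III.57)–(III.59) (pp. 352–353)] -/
theorem norm_covKernel_smearedPoly_le (hJ : J ≠ 0) (h : X → ℂ) (w w' : PIdx X L₀ N → ℝ)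
    (hw : ∀ (x : X) (m : Fin L₀), matOf w x m ∈ Matrix.unitaryGroup (Fin N) ℂ)
    (hw' : ∀ (x : X) (m : Fin L₀), matOf w' x m ∈ Matrix.unitaryGroup (Fin N) ℂ) :
    ‖covKernel J (smearedPoly h) w w'‖ ≤ ((1 + 2 * N / (J : ℝ)) ^ L₀ - 1) * ∑ x, ‖h x‖ ^ 2 := by
  have hP := fun x => polyGrowth_polyTrace_shift (J := J) w x
  have hP' := fun x => polyGrowth_polyTrace_shift (J := J) w' x
  -- expand the smeared traces
  have hexp : ∀ η : PIdx X L₀ N → ℝ,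
      conj (smearedPoly h (w' + (J : ℝ)⁻¹ • η)) * smearedPoly h (w + (J : ℝ)⁻¹ • η) =
      ∑ x, ∑ y, conj (h y) * h x *
        (conj (polyTrace (w' + (J : ℝ)⁻¹ • η) y) * polyTrace (w + (J : ℝ)⁻¹ • η) x) := by
    intro η
    unfold smearedPoly
    rw [map_sum, Finset.sum_mul_sum, Finset.sum_comm]
    refine Finset.sum_congr rfl fun x _ => Finset.sum_congr rfl fun y _ => ?_
    rw [map_mul]; ring
  have hint : ∫ η, conj (smearedPoly h (w' + (J : ℝ)⁻¹ • η)) * smearedPoly h (w + (J : ℝ)⁻¹ • η)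
      ∂gaussianPi (PIdx X L₀ N) J =
      ∑ x, ∑ y, conj (h y) * h x * ∫ η, conj (polyTrace (w' + (J : ℝ)⁻¹ • η) y) *
        polyTrace (w + (J : ℝ)⁻¹ • η) x ∂gaussianPi (PIdx X L₀ N) J := by
    simp_rw [hexp]
    have hi : ∀ x y : X, Integrable (fun η : PIdx X L₀ N → ℝ => conj (h y) * h x *
        (conj (polyTrace (w' + (J : ℝ)⁻¹ • η) y) * polyTrace (w + (J : ℝ)⁻¹ • η) x))
        (gaussianPi (PIdx X L₀ N) J) :=
      fun x y => ((PolyGrowth.const _).mul ((hP' y).cconj.mul (hP x))).integrable J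
    rw [integral_finsetSum _ fun x _ => integrable_finsetSum _ fun y _ => hi x y]
    refine Finset.sum_congr rfl fun x _ => ?_
    rw [integral_finsetSum _ fun y _ => hi x y]
    exact Finset.sum_congr rfl fun y _ => integral_const_mul _ _
  have hprod : conj (smearedPoly h w') * smearedPoly h w =
      ∑ x, ∑ y, conj (h y) * h x * (conj (polyTrace w' y) * polyTrace w x) := by
    unfold smearedPoly
    rw [map_sum, Finset.sum_mul_sum, Finset.sum_comm]
    refine Finset.sum_congr rfl fun x _ => Finset.sum_congr rfl fun y _ => ?_
    rw [map_mul]; ring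
  have hcov : covKernel J (smearedPoly h) w w' =
      ∑ x, conj (h x) * h x * ((∫ η, conj (polyTrace (w' + (J : ℝ)⁻¹ • η) x) *
        polyTrace (w + (J : ℝ)⁻¹ • η) x ∂gaussianPi (PIdx X L₀ N) J) - conj (polyTrace w' x) * polyTrace w x) := by
    unfold covKernel
    rw [hint, hprod, ← Finset.sum_sub_distrib]
    refine Finset.sum_congr rfl fun x _ => ?_
    rw [← Finset.sum_sub_distrib, Finset.sum_eq_single x (fun y _ hyx => ?_) (by simp)]
    · ring
    · rw [integral_conj_polyTrace_mul_polyTrace_of_ne J w w' (Ne.symm hyx), sub_self]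
  rw [hcov, Finset.mul_sum]
  refine (norm_sum_le _ _).trans (Finset.sum_le_sum fun x _ => ?_)
  rw [norm_mul, norm_mul, Complex.norm_conj, ← sq, mul_comm]
  exact mul_le_mul_of_nonneg_right (norm_cov_polyTrace_le J hJ w w' x (hw x) (hw' x)) (sq_nonneg _)

/-! ### Summary: the smeared Polyakov trace in the double-commutator identity -/

/-- **The hypotheses of `dcKernel_identity` for the smeared Polyakov trace**: `F = smearedPoly h`
is continuous, of polynomial growth, and has the Gaussian mean-value property. Hence, for `J > 0`
and all `w, w'`: `|F(w) − F(w')|² T_J(w, w') = B(w, w') T_J(w, w') − 𝒦(w, w')` with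
`𝒦 = dcKernel J F` a Gram kernel and, on unitary inputs, `‖B‖ ≤ ((1 + 2N/J)^{L₀} − 1) Σ ‖h x‖²`
(`norm_covKernel_smearedPoly_le`). [cite: BorgsSeiler1983, §III.2 Lemma III.6 proof, (III.33)–(III.59) (pp. 349–353)] -/
theorem dcKernel_identity_smearedPoly (hJ : J ≠ 0) (h : X → ℂ) (w w' : PIdx X L₀ N → ℝ) :
    ((Complex.normSq (smearedPoly h w - smearedPoly h w') : ℝ) : ℂ) * heatKernel J w w' =
      covKernel J (smearedPoly h) w w' * heatKernel J w w' - dcKernel J (smearedPoly h) w w' :=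
  dcKernel_identity (J := J) (F := smearedPoly h) hJ (continuous_smearedPoly h)
    (C := (∑ x, ‖h x‖) * (N * (2 * N) ^ L₀)) (n := L₀) (by positivity) (norm_smearedPoly_le h)
    (integral_smearedPoly_shift J h) w w'

end Polyakov

end Literature.MathematicalPhysics.QuantumFieldTheory

end
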